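import Summits.HodgeConjecture.HodgeConjecture.Cruxes.BlochSeedDiscOne.BnCCertCover

/-!
# BnCCertCover2 — module 2 of the «v1 + L1(.5) + ℤ (+ S) (+ O)» B&B certificate checker (dual g12, 2026-08-30)

`BnCCertCover.lean` (v4 `d0917058c35b`, 197 355 B) is at the gate's crux-write content cap (200 000 B); this module continues it in the SAME namespace:
§§27–31 (Δ6a) support disjunction `sdisj` + EFA-family leaves inside the B&B tree + two-sided no-good literal (director R19.545 (1c)); §32 two more EFA
leaf supports replayed (anomaly a6, 3831-a4); §33 first-argument slot swaps; §§34–38 (Δ6b) the ORDERED region leaf «OT-L1» (ordered e-free rows in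
the leaf functional, ordered presence ∕ ban literals, ordered same-slot aggregated (A4)-cover rows `oagg_credit` (§34b, R19.572),
`checkPtO_sound` via the ordered pass `oPt_all`, `leafO_sound`), the tree `CTreeO` with
ordered-column branching `obdisj`, `coverTO_sound`, `floorFree_of_validTO`, `regionEmpty_of_validRO`, HALF-REGION end theorem `regionPathEmpty_of_chunksO` (root path, e.g. `OPath.ofPres`), chunked interface, smoke tests (R19.545 (1c) Δ6b,
R19.549 (2), R19.563). Typed and farm-checked rc 0 ∕ axioms standard AS AN APPEND to v4 at scratch (`BnCCertCover-v6-scratch.lean`); as a separate module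
it needs `import …BnCCertCover` to elaborate on the farm, which at 2026-08-30T18Z answers `remote:stale:4:unbuilt:…BnCCertCover` (crux workfiles are
built lazily; the two-deep chain BnCCert → BnCCertCover → this does not build) — LAND THIS FILE with
`ledger crux write stmt-HodgeConjecture-18881 BnCCertCover2.lean --file …` once the farm has built BnCCertCover.
Nothing here is proved toward `FloorFree 6 199 8` ∕ 18881 ∕ HC: three leaf SUPPORTS are refuted in the kernel (§26 in module 1, §32 here), no region, no floor.
-/

set_option linter.dupNamespace false
set_option autoImplicit false

namespace Summit.HodgeConjecture.HodgeConjecture.Cruxes.BlochSeedDiscOne.BnCCertCover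

open Summit.HodgeConjecture.HodgeConjecture.Cruxes.BlochSeedDiscOne.DepthBoundA4
open Summit.HodgeConjecture.HodgeConjecture.Cruxes.BlochSeedDiscOne.RingFiveEmpty
open Summit.HodgeConjecture.HodgeConjecture.Cruxes.BlochSeedDiscOne.BnCCert

/-! ## §27 (Δ6a) SUPPORT DISJUNCTION «supp ⊆ S ∨ a supported cell lies outside S»: the no-good literal (LP row `x(adm ∖ S) ≥ 1`, multiplier
`Z ≥ 0`: pays `Z` on every column not matched by `S`, credits `Z`), and the type-level pointwise check with an extra slot-symmetric pay.
Nothing here is a certificate; nothing toward `FloorFree 6 199 8`. -/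

/-- no-good record: support list `S` (side-tagged multiset types), multiplier `Z ≥ 0` of `x(adm ∖ S) ≥ 1` -/
structure NoGood where
  S : List (Side × STuple)
  Z : ℤ

/-- the type `t` on side `sd` is matched, up to a slot permutation, by an entry of `S` on the same side -/
def matchedS (S : List (Side × STuple)) (sd : Side) (t : STuple) : Bool := S.any fun e => massHit ⟨e.1, e.2, 0, 0⟩ sd t

theorem matchedS_swap01 (S : List (Side × STuple)) (sd : Side) (x y z w : Shape) : matchedS S sd ![y, x, z, w] = matchedS S sd ![x, y, z, w] := by
  simp only [matchedS, massHit_swap01 _ _ x y z w]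
theorem matchedS_swap12 (S : List (Side × STuple)) (sd : Side) (x y z w : Shape) : matchedS S sd ![x, z, y, w] = matchedS S sd ![x, y, z, w] := by
  simp only [matchedS, massHit_swap12 _ _ x y z w]
theorem matchedS_swap23 (S : List (Side × STuple)) (sd : Side) (x y z w : Shape) : matchedS S sd ![x, y, w, z] = matchedS S sd ![x, y, z, w] := by
  simp only [matchedS, massHit_swap23 _ _ x y z w]

/-- the no-good pay on a column: `Σ_g Z_g·[t not matched by S_g]` -/
def ngPay (ngs : List NoGood) (sd : Side) (t : STuple) : ℤ := (ngs.map fun g => if matchedS g.S sd t then 0 else g.Z).sum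

theorem ngPay_swap01 (ngs : List NoGood) (sd : Side) (x y z w : Shape) : ngPay ngs sd ![y, x, z, w] = ngPay ngs sd ![x, y, z, w] := by
  simp only [ngPay, matchedS_swap01 _ _ x y z w]
theorem ngPay_swap12 (ngs : List NoGood) (sd : Side) (x y z w : Shape) : ngPay ngs sd ![x, z, y, w] = ngPay ngs sd ![x, y, z, w] := by
  simp only [ngPay, matchedS_swap12 _ _ x y z w]
theorem ngPay_swap23 (ngs : List NoGood) (sd : Side) (x y z w : Shape) : ngPay ngs sd ![x, y, w, z] = ngPay ngs sd ![x, y, z, w] := by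
  simp only [ngPay, matchedS_swap23 _ _ x y z w]

/-- semantic form of the no-good literal: some supported cell (on some side) has a type outside `S` -/
def OutsideS (D : Design) (S : List (Side × STuple)) : Prop := ∃ sd : Side, ∃ c ∈ suppSide D sd, matchedS S sd (typeOf c) = false

/-- the two branches of the support disjunction are exhaustive -/
theorem outsideS_of_not_suppIn {D : Design} {S : List (Side × STuple)} (h : ¬ SuppIn D S) : OutsideS D S := by
  unfold SuppIn at h
  push Not at h
  obtain ⟨sd, c, hc, hno⟩ := h
  refine ⟨sd, c, hc, eq_false_of_ne_true fun hm => ?_⟩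
  simp only [matchedS, List.any_eq_true, massHit, Bool.and_eq_true, decide_eq_true_eq] at hm
  obtain ⟨e, he, hsd, hsm⟩ := hm
  exact hno e he hsd hsm

theorem ngPay_nonneg (ngs : List NoGood) (hZ : ∀ g ∈ ngs, 0 ≤ g.Z) (sd : Side) (t : STuple) : 0 ≤ ngPay ngs sd t := by
  unfold ngPay
  refine List.sum_nonneg ?_
  intro x hx
  obtain ⟨g, hg, rfl⟩ := List.mem_map.mp hx
  by_cases hm : matchedS g.S sd t = true
  · simp [hm]
  · simp [hm, hZ g hg]

/-- (credit 7) no-good literals: `Σ_g Z_g ≤ Σ_c m(c)·ngPay(c)` -/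
theorem ng_credit (D : Design) (ngs : List NoGood) (hZ : ∀ g ∈ ngs, 0 ≤ g.Z) (hng : ∀ g ∈ ngs, OutsideS D g.S) :
    (ngs.map fun g => g.Z).sum ≤ linZ D.N (fun c => ngPay ngs Side.N (typeOf c)) + linZ D.P (fun c => ngPay ngs Side.P (typeOf c)) := by
  induction ngs with
  | nil => simp [ngPay, linZ]
  | cons g rest ih =>
      have hZ' : ∀ g' ∈ rest, 0 ≤ g'.Z := fun g' hg' => hZ g' (List.mem_cons.mpr (Or.inr hg'))
      have hng' : ∀ g' ∈ rest, OutsideS D g'.S := fun g' hg' => hng g' (List.mem_cons.mpr (Or.inr hg'))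
      have ih' := ih hZ' hng'
      have hsplit : ∀ sd : Side, (fun c => ngPay (g :: rest) sd (typeOf c)) =
          fun c => (if matchedS g.S sd (typeOf c) then 0 else g.Z) + ngPay rest sd (typeOf c) := by
        intro sd; funext c; simp [ngPay]
      rw [hsplit Side.N, hsplit Side.P, linZ_add, linZ_add]
      obtain ⟨sd₀, c₀, hc₀, hm₀⟩ := hng g (List.mem_cons.mpr (Or.inl rfl))
      have hg0 : 0 ≤ g.Z := hZ g (List.mem_cons.mpr (Or.inl rfl))
      have key := one_le_linZ_sides D (fun sd c => if matchedS g.S sd (typeOf c) then (0 : ℤ) else 1)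
        (fun sd c => by by_cases hm : matchedS g.S sd (typeOf c) = true <;> simp [hm]) hc₀ (by simp [hm₀])
      have eN : (fun c => if matchedS g.S Side.N (typeOf c) then (0 : ℤ) else g.Z) =
          fun c => g.Z * (if matchedS g.S Side.N (typeOf c) then (0 : ℤ) else 1) := by
        funext c; split <;> simp
      have eP : (fun c => if matchedS g.S Side.P (typeOf c) then (0 : ℤ) else g.Z) =
          fun c => g.Z * (if matchedS g.S Side.P (typeOf c) then (0 : ℤ) else 1) := by
        funext c; split <;> simp
      rw [eN, eP, linZ_smul, linZ_smul]
      simp only [List.map_cons, List.sum_cons]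
      nlinarith [key, hg0, ih']

/-- `checkPtK` (Δ3) with an EXTRA slot-symmetric type pay `X sd t` -/
def checkPtX (h : ℕ) (bs : List Bound) (E : List (Var × VarRec)) (γ : Coefs) (L ρ : ℤ) (bans : List (Side × STuple)) (pres : List Pres)
    (kbans : List KLit) (kpres : List KPres) (ephi : List EPhi) (X : Side → STuple → ℤ) (sd : Side) : Bool :=
  (admTypesSorted h bs sd).all fun t =>
    banHit bans sd t || decide (0 < emptyCnt sd kbans t) ||
      decide (sd.sgn * Gtype γ t + coverPay E sd t + presPay pres sd t + QK sd ephi kpres kbans t + X sd t ≤ sd.bnd L ρ)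

def KPtX (h : ℕ) (bs : List Bound) (E : List (Var × VarRec)) (γ : Coefs) (L ρ : ℤ) (bans : List (Side × STuple)) (pres : List Pres)
    (kbans : List KLit) (kpres : List KPres) (ephi : List EPhi) (X : Side → STuple → ℤ) (sd : Side) (x y z w : Shape) : Prop :=
  admType h bs sd ![x, y, z, w] = true → banHit bans sd ![x, y, z, w] = false → emptyCnt sd kbans ![x, y, z, w] = 0 →
    sd.sgn * Gtype γ ![x, y, z, w] + coverPay E sd ![x, y, z, w] + presPay pres sd ![x, y, z, w] + QK sd ephi kpres kbans ![x, y, z, w]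
      + X sd ![x, y, z, w] ≤ sd.bnd L ρ

/-- slot symmetry of an extra type pay -/
structure SlotSymm (X : Side → STuple → ℤ) : Prop where
  s01 : ∀ (sd : Side) (x y z w : Shape), X sd ![y, x, z, w] = X sd ![x, y, z, w]
  s12 : ∀ (sd : Side) (x y z w : Shape), X sd ![x, z, y, w] = X sd ![x, y, z, w]
  s23 : ∀ (sd : Side) (x y z w : Shape), X sd ![x, y, w, z] = X sd ![x, y, z, w]

theorem ngPay_slotSymm (ngs : List NoGood) : SlotSymm (ngPay ngs) :=
  ⟨fun sd x y z w => ngPay_swap01 ngs sd x y z w, fun sd x y z w => ngPay_swap12 ngs sd x y z w, fun sd x y z w => ngPay_swap23 ngs sd x y z w⟩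

theorem kPtX_all {h : ℕ} {bs : List Bound} {E : List (Var × VarRec)} {γ : Coefs} {L ρ : ℤ} {bans : List (Side × STuple)} {pres : List Pres}
    {kbans : List KLit} {kpres : List KPres} {ephi : List EPhi} {X : Side → STuple → ℤ} {sd : Side} (hX : SlotSymm X)
    (hchk : ∀ t ∈ admTypesSorted h bs sd, (banHit bans sd t = true ∨ 0 < emptyCnt sd kbans t) ∨
      sd.sgn * Gtype γ t + coverPay E sd t + presPay pres sd t + QK sd ephi kpres kbans t + X sd t ≤ sd.bnd L ρ) :
    ∀ x y z w, KPtX h bs E γ L ρ bans pres kbans kpres ephi X sd x y z w := by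
  refine forall_of_sorted4 (rankOf (adm0 h sd)) (KPtX h bs E γ L ρ bans pres kbans kpres ephi X sd) ?_ ?_ ?_ ?_
  · intro x y z w hP ha hb he
    rw [banHit_swap01] at hb
    rw [emptyCnt_swap01] at he
    have := hP (admType_swap01 h bs sd x y z w ha) hb he
    rw [← Gtype_swap01, ← coverPay_swap01, ← presPay_swap01, ← QK_swap01, ← hX.s01] at this
    exact this
  · intro x y z w hP ha hb he
    rw [banHit_swap12] at hb
    rw [emptyCnt_swap12] at he
    have := hP (admType_swap12 h bs sd x y z w ha) hb he
    rw [← Gtype_swap12, ← coverPay_swap12, ← presPay_swap12, ← QK_swap12, ← hX.s12] at this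
    exact this
  · intro x y z w hP ha hb he
    rw [banHit_swap23] at hb
    rw [emptyCnt_swap23] at he
    have := hP (admType_swap23 h bs sd x y z w ha) hb he
    rw [← Gtype_swap23, ← coverPay_swap23, ← presPay_swap23, ← QK_swap23, ← hX.s23] at this
    exact this
  · intro x y z w h1 h2 h3 ha hb he
    have hx : (adm0 h sd).elem x = true := by simpa using admType_static ha 0
    have hy : (adm0 h sd).elem y = true := by simpa using admType_static ha 1
    have hz : (adm0 h sd).elem z = true := by simpa using admType_static ha 2
    have hw : (adm0 h sd).elem w = true := by simpa using admType_static ha 3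
    rcases hchk _ (List.mem_filter.mpr ⟨mem_stuples _ x y z w (List.mem_of_elem_eq_true hx) (List.mem_of_elem_eq_true hy)
      (List.mem_of_elem_eq_true hz) (List.mem_of_elem_eq_true hw) h1 h2 h3, ha⟩) with (hban | hemp) | hle
    · rw [hb] at hban
      exact absurd hban Bool.false_ne_true
    · rw [he] at hemp
      exact absurd hemp (lt_irrefl 0)
    · exact hle

/-- as `checkPtK_sound`, the extra pay carried along -/
theorem checkPtX_sound {h : ℕ} {bs : List Bound} {E : List (Var × VarRec)} {γ : Coefs} {L ρ : ℤ} {bans : List (Side × STuple)} {pres : List Pres}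
    {kbans : List KLit} {kpres : List KPres} {ephi : List EPhi} {X : Side → STuple → ℤ} {sd : Side} (hX : SlotSymm X)
    (hchk : checkPtX h bs E γ L ρ bans pres kbans kpres ephi X sd = true) (c : Cell)
    (hadm : admType h bs sd (typeOf c) = true) (hnb : banHit bans sd (typeOf c) = false) (hkb : ∀ f : Fin 4, kbanAt kbans sd (typeOf c) (c f) = false) :
    sd.sgn * (Gcell γ c + GE ephi c) + (coverPay E sd (typeOf c) + presPay pres sd (typeOf c) + keyPay kpres sd c + X sd (typeOf c)) ≤ sd.bnd L ρ := by
  simp only [checkPtX, List.all_eq_true, Bool.or_eq_true, decide_eq_true_eq] at hchk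
  have ht : (![typeOf c 0, typeOf c 1, typeOf c 2, typeOf c 3] : STuple) = typeOf c := by
    funext f; fin_cases f <;> rfl
  have hmem : ∀ f : Fin 4, c f ∈ cand kbans sd (typeOf c) (typeOf c f) := fun f =>
    List.mem_filter.mpr ⟨mem_letters_shapeOf (c f), by simp [hkb f]⟩
  have hempty : emptyCnt sd kbans (typeOf c) = 0 := by
    simp only [emptyCnt, isEmpty_false_of_mem (hmem 0), isEmpty_false_of_mem (hmem 1), isEmpty_false_of_mem (hmem 2),
      isEmpty_false_of_mem (hmem 3), indB]
    simp
  have hP := kPtX_all hX hchk (typeOf c 0) (typeOf c 1) (typeOf c 2) (typeOf c 3)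
  rw [KPtX, ht] at hP
  have hineq := hP hadm hnb hempty
  have hslots : sd.sgn * GE ephi c + keyPay kpres sd c =
      slotVal sd ephi kpres (typeOf c) (pas0 (typeOf c)) (c 0) + slotVal sd ephi kpres (typeOf c) (pas1 (typeOf c)) (c 1)
        + slotVal sd ephi kpres (typeOf c) (pas2 (typeOf c)) (c 2) + slotVal sd ephi kpres (typeOf c) (pas3 (typeOf c)) (c 3) := by
    rw [keyPay_eq_slots]
    simp only [GE, slotVal]
    ring
  have hle : ∀ (σ : Shape) (π : STri) (ℓ : Letter), ℓ ∈ cand kbans sd (typeOf c) σ →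
      slotVal sd ephi kpres (typeOf c) π ℓ ≤ slotMax sd ephi kpres kbans (typeOf c) σ π :=
    fun σ π ℓ hℓ => le_lmax1_of_mem (List.mem_map.mpr ⟨ℓ, hℓ, rfl⟩)
  have h0 := hle _ (pas0 (typeOf c)) _ (hmem 0)
  have h1 := hle _ (pas1 (typeOf c)) _ (hmem 1)
  have h2 := hle _ (pas2 (typeOf c)) _ (hmem 2)
  have h3 := hle _ (pas3 (typeOf c)) _ (hmem 3)
  rw [Gcell_eq_Gtype]
  unfold QK at hineq
  have hdist : sd.sgn * (Gtype γ (typeOf c) + GE ephi c) = sd.sgn * Gtype γ (typeOf c) + sd.sgn * GE ephi c := by ring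
  linarith [hslots, h0, h1, h2, h3, hineq]

/-! ## §28 (Δ6a) The leaf with no-good literals («v1 + L1.5 + ℤ + S») and its Farkas soundness -/

structure LeafN where
  m : LeafM
  ngs : List NoGood

/-- M-layer data, leaves with no-goods, EFA FAMILIES (§25) usable as tree leaves -/
structure CertN where
  h : ℕ
  B : ℕ
  rmin : ℤ
  vars : List Var
  leaves : List LeafN
  fams : List EFAFam

def CertN.toM (C : CertN) : CertM := ⟨C.h, C.B, C.rmin, C.vars, C.leaves.map fun lf => lf.m⟩

def LeafN.LitsHold (lf : LeafN) (D : Design) : Prop := lf.m.LitsHold D ∧ ∀ g ∈ lf.ngs, OutsideS D g.S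

/-- Δ4's core conjuncts + `Z ≥ 0` for the no-goods + closing WITH `+ Σ_g Z_g` -/
def checkCoreN (C : CertN) (lf : LeafN) : Bool :=
  let E := ents C.vars lf.m.core.base
  let bs := allBounds C.vars lf.m.core.base
  decide (lf.m.core.base.recs.length = C.vars.length) &&
  checkDerivedAll C.h (primaryBounds E) lf.m.core.base.derived &&
  decide (0 ≤ lf.m.core.base.L) && decide (0 ≤ lf.m.core.base.ρ) &&
  (E.all fun e => decide (0 ≤ e.2.Y) && thrOK C.h bs lf.m.core.base.laws e) &&
  (lf.m.core.pres.all fun r => decide (0 ≤ r.Z) && decide (0 ≤ r.W)) &&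
  (lf.m.core.kpres.all fun r => decide (0 ≤ r.Z) && decide (0 ≤ r.W)) &&
  (lf.m.mges.all fun r => decide (0 ≤ r.Z)) &&
  (lf.m.mles.all fun r => decide (0 ≤ r.U)) &&
  (lf.m.aggs.all fun r => decide (0 ≤ r.V)) &&
  (lf.ngs.all fun g => decide (0 ≤ g.Z)) &&
  (rowsE lf.m.core.ephi).all rowOK &&
  decide (lf.m.core.base.L * (C.B : ℤ) < (E.map fun e => e.2.Y * (e.2.thr : ℤ)).sum + lf.m.core.base.ρ * C.rmin
    + (lf.m.core.pres.map fun r => r.Z + r.W).sum + (lf.m.core.kpres.map fun r => r.Z + r.W).sum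
    + (lf.m.mges.map fun r => r.Z * (r.k : ℤ)).sum - (lf.m.mles.map fun r => r.U * (r.k : ℤ)).sum + (lf.ngs.map fun g => g.Z).sum)

/-- **leaf check** («v1 + L1.5 + ℤ + S») -/
def checkLeafN (C : CertN) (lf : LeafN) : Bool :=
  match lf.m.core.base.func with
  | Func.cls γ =>
      checkCoreN C lf &&
      checkPtX C.h (allBounds C.vars lf.m.core.base) (ents C.vars lf.m.core.base) γ lf.m.core.base.L lf.m.core.base.ρ lf.m.core.bans (lf.m.presEff C.B)
        lf.m.core.kbans lf.m.core.kpres lf.m.core.ephi (ngPay lf.ngs) Side.N &&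
      checkPtX C.h (allBounds C.vars lf.m.core.base) (ents C.vars lf.m.core.base) γ lf.m.core.base.L lf.m.core.base.ρ lf.m.core.bans (lf.m.presEff C.B)
        lf.m.core.kbans lf.m.core.kpres lf.m.core.ephi (ngPay lf.ngs) Side.P
  | Func.cell _ => false

theorem checkLeafN_cls {C : CertN} {lf : LeafN} (h : checkLeafN C lf = true) :
    ∃ γ : Coefs, lf.m.core.base.func = Func.cls γ ∧ checkCoreN C lf = true ∧
      checkPtX C.h (allBounds C.vars lf.m.core.base) (ents C.vars lf.m.core.base) γ lf.m.core.base.L lf.m.core.base.ρ lf.m.core.bans (lf.m.presEff C.B)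
        lf.m.core.kbans lf.m.core.kpres lf.m.core.ephi (ngPay lf.ngs) Side.N = true ∧
      checkPtX C.h (allBounds C.vars lf.m.core.base) (ents C.vars lf.m.core.base) γ lf.m.core.base.L lf.m.core.base.ρ lf.m.core.bans (lf.m.presEff C.B)
        lf.m.core.kbans lf.m.core.kpres lf.m.core.ephi (ngPay lf.ngs) Side.P = true := by
  unfold checkLeafN at h
  split at h
  · rename_i γ hγ
    simp only [Bool.and_eq_true] at h
    exact ⟨γ, hγ, h.1.1, h.1.2, h.2⟩
  · exact absurd h Bool.false_ne_true

theorem hder_of_checkLeafN {C : CertN} {lf : LeafN} (h : checkLeafN C lf = true) :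
    checkDerivedAll C.h (primaryBounds (ents C.vars lf.m.core.base)) lf.m.core.base.derived = true := by
  obtain ⟨γ, _, hcore, _, _⟩ := checkLeafN_cls h
  simp only [checkCoreN, Bool.and_eq_true, decide_eq_true_eq] at hcore
  obtain ⟨⟨⟨⟨⟨⟨⟨⟨⟨⟨⟨⟨_, hder⟩, _⟩, _⟩, _⟩, _⟩, _⟩, _⟩, _⟩, _⟩, _⟩, _⟩, _⟩ := hcore
  exact hder

/-- **LEAF FARKAS («v1 + L1.5 + ℤ + S») — PROVED** (`leafM_sound` + credit (7) of the no-goods). -/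
theorem leafN_sound (C : CertN) (lf : LeafN) (hlf : checkLeafN C lf = true) (D : Design) (h1 : D.A1) (h4 : D.A4)
    (hB : D.copies ≤ C.B) (hr : C.rmin ≤ D.rank) (hN : D.suppN ≠ []) (hP : D.suppP ≠ [])
    (hreg : InRegion C.vars lf.m.core.base D)
    (hadm : ∀ sd : Side, ∀ c' ∈ suppSide D sd, admType C.h (allBounds C.vars lf.m.core.base) sd (typeOf c') = true)
    (hlits : lf.LitsHold D) (hparity : ParityOK C.toM.toB lf.m.core.base D) : False := by
  obtain ⟨⟨⟨hbans, hpres, hkbans, hkpres⟩, hmges, hmles⟩, hngs⟩ := hlits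
  obtain ⟨γ, _hfunc, hcore, hNall, hPall⟩ := checkLeafN_cls hlf
  simp only [checkCoreN, Bool.and_eq_true, decide_eq_true_eq, List.all_eq_true] at hcore
  obtain ⟨⟨⟨⟨⟨⟨⟨⟨⟨⟨⟨⟨_hlen, _hder⟩, hL⟩, hρ⟩, hYthr⟩, hZW⟩, hKZW⟩, hMZ⟩, hMU⟩, hAV⟩, hNG⟩, hrows⟩, hclose⟩ := hcore
  have hrows' : (rowsE lf.m.core.ephi).all rowOK = true := List.all_eq_true.mpr hrows
  refine farkas_core D C.B C.rmin hB hr (fun c => Gcell γ c + GE lf.m.core.ephi c) ?_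
    (fun sd c => coverPay (ents C.vars lf.m.core.base) sd (typeOf c) + presPay (lf.m.presEff C.B) sd (typeOf c) + keyPay lf.m.core.kpres sd c
      + ngPay lf.ngs sd (typeOf c))
    (((ents C.vars lf.m.core.base).map fun e => e.2.Y * (e.2.thr : ℤ)).sum + (lf.m.core.pres.map fun r => r.Z + r.W).sum
      + (lf.m.core.kpres.map fun r => r.Z + r.W).sum + (lf.m.mges.map fun r => r.Z * (r.k : ℤ)).sum - (lf.m.mles.map fun r => r.U * (r.k : ℤ)).sum
      + (lf.ngs.map fun g => g.Z).sum)
    lf.m.core.base.L lf.m.core.base.ρ hL hρ ?_ ?_ ?_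
  · have hG := G_vanishes D h1 γ
    have hE := GE_balance D h1 lf.m.core.ephi hrows'
    rw [linZ_add, linZ_add]
    have e1 : linZ D.N (fun c => Gcell γ c) = linZ D.N (Gcell γ) := rfl
    have e2 : linZ D.P (fun c => Gcell γ c) = linZ D.P (Gcell γ) := rfl
    have e3 : linZ D.N (fun c => GE lf.m.core.ephi c) = linZ D.N (GE lf.m.core.ephi) := rfl
    have e4 : linZ D.P (fun c => GE lf.m.core.ephi c) = linZ D.P (GE lf.m.core.ephi) := rfl
    rw [e1, e2, e3, e4]
    linarith
  · have h1c := coverPay_credit C.toM.toB lf.m.core.base D hYthr hreg hN hP hparity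
    have h2c := presPay_credit D h4 lf.m.core.pres hZW hpres
    have h3c := keyPay_credit D h4 lf.m.core.kpres hKZW hkpres
    have h4c := mge_credit D lf.m.mges hMZ hmges
    have h5c := mle_credit D lf.m.mles hMU hmles
    have h6c := agg_credit D h4 C.B hB lf.m.aggs hAV
    have h7c := ng_credit D lf.ngs hNG hngs
    change ((ents C.vars lf.m.core.base).map fun e => e.2.Y * (e.2.thr : ℤ)).sum
      ≤ linZ D.N (fun c => coverPay (ents C.vars lf.m.core.base) Side.N (typeOf c)) + linZ D.P (fun c => coverPay (ents C.vars lf.m.core.base) Side.P (typeOf c))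
      at h1c
    simp only [LeafM.presEff, presPay_append, linZ_add]
    linarith
  · intro sd c hc
    have hnb := banHit_false_of_banned hbans hc
    have hkb : ∀ f : Fin 4, kbanAt lf.m.core.kbans sd (typeOf c) (c f) = false := fun f => kbanAt_false_of_kbanned hkbans hc f
    cases sd with
    | N => exact checkPtX_sound (ngPay_slotSymm lf.ngs) hNall c (hadm Side.N c hc) hnb hkb
    | P => exact checkPtX_sound (ngPay_slotSymm lf.ngs) hPall c (hadm Side.P c hc) hnb hkb
  · linarith

/-! ## §29 (Δ6a) The tree with SUPPORT-DISJUNCTION nodes and EFA-FAMILY leaves, and its soundness -/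

/-- Δ4's tree + `efa j` (the `j`-th EFA family as a leaf) + `sdisj S A B` («supp ⊆ S up to slot permutation, side-matched» ∕ «not») -/
inductive CTreeN where
  | leaf (i : ℕ)
  | efa (j : ℕ)
  | node (q : ℕ) (kids : List CTreeN)
  | disj (sd : Side) (τ : STuple) (absent present : CTreeN)
  | kdisj (sd : Side) (τ : STuple) (ℓ : Letter) (absent present : CTreeN)
  | mdisj (sd : Side) (τ : STuple) (k : ℕ) (atMost atLeast : CTreeN)
  | sdisj (S : List (Side × STuple)) (inside outside : CTreeN)

structure NPath where
  m : MPath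
  only : List (List (Side × STuple))
  ngs : List (List (Side × STuple))

def NPath.Holds (p : NPath) (D : Design) : Prop :=
  p.m.Holds D ∧ (∀ S ∈ p.only, SuppIn D S) ∧ (∀ S ∈ p.ngs, OutsideS D S)

def NPath.nil : NPath := ⟨MPath.nil, [], []⟩

theorem NPath.nil_holds (D : Design) : NPath.nil.Holds D := ⟨MPath.nil_holds D, by simp [NPath.nil], by simp [NPath.nil]⟩

/-- syntactic equality of support lists (side by `decide`, types by `eqT`) -/
def eqSL : List (Side × STuple) → List (Side × STuple) → Bool
  | [], [] => true
  | e :: l, e' :: l' => decide (e.1 = e'.1) && eqT e.2 e'.2 && eqSL l l'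
  | _, _ => false

theorem eqSL_eq : ∀ {l l' : List (Side × STuple)}, eqSL l l' = true → l = l'
  | [], [], _ => rfl
  | [], _ :: _, h => by simp [eqSL] at h
  | _ :: _, [], h => by simp [eqSL] at h
  | e :: l, e' :: l', h => by
      simp only [eqSL, Bool.and_eq_true, decide_eq_true_eq] at h
      obtain ⟨⟨h1, h2⟩, h3⟩ := h
      have he : e = e' := Prod.ext h1 (eqT_eq h2)
      rw [he, eqSL_eq h3]

def memSL (ls : List (List (Side × STuple))) (S : List (Side × STuple)) : Bool := ls.any fun S' => eqSL S' S

theorem memSL_sound {ls : List (List (Side × STuple))} {S : List (Side × STuple)} (h : memSL ls S = true) : S ∈ ls := by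
  simp only [memSL, List.any_eq_true] at h
  obtain ⟨S', hS', he⟩ := h
  rw [← eqSL_eq he]
  exact hS'

/-- LP leaf fits: Δ4's fitting + each no-good's list is (syntactically) on the path's `ngs` -/
def leafFitsN (lf : LeafN) (asg : List (Option ℕ)) (p : NPath) : Bool :=
  leafFitsM lf.m asg p.m && lf.ngs.all fun g => memSL p.ngs g.S

theorem leafFitsN_sound {lf : LeafN} {asg : List (Option ℕ)} {p : NPath} (h : leafFitsN lf asg p = true) (D : Design) (hp : p.Holds D) :
    lf.m.core.base.recs.map VarRec.cap = asg ∧ lf.LitsHold D := by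
  simp only [leafFitsN, Bool.and_eq_true, List.all_eq_true] at h
  obtain ⟨hM, hng⟩ := h
  obtain ⟨hpM, _, hpng⟩ := hp
  obtain ⟨hcaps, hlitsM⟩ := leafFitsM_sound hM D hpM
  exact ⟨hcaps, hlitsM, fun g hg => hpng g.S (memSL_sound (hng g hg))⟩

/-- EFA leaf fits: `F.B = C.B`, `F.supp` (syntactically) on `only`, multiset anchor `(sd0, τ)` (syntactically) on `pres`; region irrelevant -/
def efaFits (F : EFAFam) (B : ℕ) (p : NPath) : Bool := decide (F.B = B) && memSL p.only F.supp && memLit p.m.pres (F.sd0, F.τ)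

theorem efaFits_sound {F : EFAFam} {B : ℕ} {p : NPath} (h : efaFits F B p = true) (D : Design) (hp : p.Holds D) :
    F.B = B ∧ SuppIn D F.supp ∧ Present D F.sd0 F.τ := by
  simp only [efaFits, Bool.and_eq_true, decide_eq_true_eq] at h
  obtain ⟨⟨hB, hS⟩, hl⟩ := h
  obtain ⟨hpM, hpo, _⟩ := hp
  obtain ⟨b', hb', h1, h2⟩ := memLit_sound hl
  refine ⟨hB, hpo F.supp (memSL_sound hS), ?_⟩
  have := hpM.1.2.1 b' hb'
  rw [h1, h2] at this
  exact this

/-- cover check with fuel (Δ4's + the EFA leaf + `sdisj`, which pushes `S` onto `only` ∕ `ngs`) -/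
def coverTN (C : CertN) : CTreeN → ℕ → List (Option ℕ) → NPath → Bool
  | .leaf i, _, asg, p =>
      match C.leaves[i]? with
      | some lf => leafFitsN lf asg p
      | none => false
  | .efa j, _, _, p =>
      match C.fams[j]? with
      | some F => efaFits F C.B p
      | none => false
  | .node _ _, 0, _, _ => false
  | .node q kids, fuel + 1, asg, p =>
      decide (q < asg.length) && decide (kids.length = 5) &&
        ((List.range 5).all fun k =>
          match kids[k]? with
          | some t => coverTN C t fuel (setAt asg q k) p
          | none => false)
  | .disj _ _ _ _, 0, _, _ => false
  | .disj sd τ A B, fuel + 1, asg, p =>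
      coverTN C A fuel asg {p with m := {p.m with bans := (sd, τ) :: p.m.bans}} &&
        coverTN C B fuel asg {p with m := {p.m with pres := (sd, τ) :: p.m.pres}}
  | .kdisj _ _ _ _ _, 0, _, _ => false
  | .kdisj sd τ ℓ A B, fuel + 1, asg, p =>
      coverTN C A fuel asg {p with m := {p.m with kbans := (sd, τ, ℓ) :: p.m.kbans}} &&
        coverTN C B fuel asg {p with m := {p.m with kpres := (sd, τ, ℓ) :: p.m.kpres}}
  | .mdisj _ _ _ _ _, 0, _, _ => false
  | .mdisj sd τ k A B, fuel + 1, asg, p =>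
      coverTN C A fuel asg {p with m := {p.m with mles := (sd, τ, k) :: p.m.mles}} &&
        coverTN C B fuel asg {p with m := {p.m with mges := (sd, τ, k + 1) :: p.m.mges}}
  | .sdisj _ _ _, 0, _, _ => false
  | .sdisj S A B, fuel + 1, asg, p =>
      coverTN C A fuel asg {p with only := S :: p.only} && coverTN C B fuel asg {p with ngs := S :: p.ngs}

def rootCoverTN (C : CertN) (t : CTreeN) (fuel : ℕ) : Bool :=
  match t with
  | .node 0 kids =>
      decide (0 < C.vars.length) && decide (kids.length = 5) &&
        ((List.range 5).all fun k => decide (k = 0) ||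
          match kids[k]? with
          | some s => coverTN C s fuel (setAt (List.replicate C.vars.length none) 0 k) NPath.nil
          | none => false)
  | _ => coverTN C t fuel (List.replicate C.vars.length none) NPath.nil

/-- **whole-node checker** («v1 + L1.5 + ℤ + S») -/
def validTN (C : CertN) (t : CTreeN) (fuel : ℕ) : Bool :=
  decide (C.vars[0]? = some ⟨Side.P, floorStat C.h⟩) &&
  (C.leaves.all fun lf => checkLeafN C lf) &&
  (C.fams.all validEFAFam) &&
  rootCoverTN C t fuel

/-- **the per-REGION checker** («v1 + L1.5 + ℤ + S») -/
def validRN (C : CertN) (t : CTreeN) (fuel : ℕ) (caps : List (Option ℕ)) : Bool :=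
  decide (caps.length = C.vars.length) &&
  (C.leaves.all fun lf => checkLeafN C lf) &&
  (C.fams.all validEFAFam) &&
  coverTN C t fuel caps NPath.nil

/-- cover yields: an LP leaf of the region whose literals hold, OR an EFA family with `SuppIn` + anchor `Present` -/
def LeafOrEFA (C : CertN) (D : Design) (ks : List ℕ) : Prop :=
  (∃ lf ∈ C.leaves, matchesB (lf.m.core.base.recs.map VarRec.cap) ks = true ∧ lf.LitsHold D) ∨
  (∃ F ∈ C.fams, F.B = C.B ∧ SuppIn D F.supp ∧ Present D F.sd0 F.τ)

theorem coverTN_sound (C : CertN) (D : Design) (ks : List ℕ) (hks : ∀ k ∈ ks, k < 5) :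
    ∀ (fuel : ℕ) (t : CTreeN) (asg : List (Option ℕ)) (p : NPath),
      coverTN C t fuel asg p = true →
      (asg.length = ks.length ∧ ∀ j m : ℕ, asg[j]? = some (some m) → ks[j]? = some m) → p.Holds D → LeafOrEFA C D ks := by
  have hleaf : ∀ (fuel i : ℕ) (asg : List (Option ℕ)) (p : NPath), coverTN C (.leaf i) fuel asg p = true →
      (asg.length = ks.length ∧ ∀ j m : ℕ, asg[j]? = some (some m) → ks[j]? = some m) → p.Holds D → LeafOrEFA C D ks := by
    intro fuel i asg p h hag hp
    rcases hi : C.leaves[i]? with _ | lf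
    · simp [coverTN, hi] at h
    · simp only [coverTN, hi] at h
      obtain ⟨hcaps, hlits⟩ := leafFitsN_sound h D hp
      subst hcaps
      exact Or.inl ⟨lf, List.mem_of_getElem? hi, matchesB_of_agrees hag, hlits⟩
  have hefa : ∀ (fuel j : ℕ) (asg : List (Option ℕ)) (p : NPath), coverTN C (.efa j) fuel asg p = true → p.Holds D → LeafOrEFA C D ks := by
    intro fuel j asg p h hp
    rcases hj : C.fams[j]? with _ | F
    · simp [coverTN, hj] at h
    · simp only [coverTN, hj] at h
      exact Or.inr ⟨F, List.mem_of_getElem? hj, efaFits_sound h D hp⟩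
  intro fuel
  induction fuel with
  | zero =>
      intro t asg p h hag hp
      cases t with
      | leaf i => exact hleaf 0 i asg p h hag hp
      | efa j => exact hefa 0 j asg p h hp
      | node q kids => simp [coverTN] at h
      | disj sd τ A B => simp [coverTN] at h
      | kdisj sd τ ℓ A B => simp [coverTN] at h
      | mdisj sd τ k A B => simp [coverTN] at h
      | sdisj S A B => simp [coverTN] at h
  | succ n ih =>
      intro t asg p h hag hp
      cases t with
      | leaf i => exact hleaf (n + 1) i asg p h hag hp
      | efa j => exact hefa (n + 1) j asg p h hp
      | node q kids =>
          simp only [coverTN, Bool.and_eq_true, decide_eq_true_eq, List.all_eq_true] at h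
          obtain ⟨⟨hq, hlen5⟩, hall⟩ := h
          have hqk : q < ks.length := by rw [← hag.1]; exact hq
          obtain ⟨k, hk⟩ : ∃ k, ks[q]? = some k := ⟨ks[q], List.getElem?_eq_getElem hqk⟩
          have hk5 : k < 5 := hks k (List.mem_of_getElem? hk)
          have hs := hall k (List.mem_range.mpr hk5)
          obtain ⟨s, hsk⟩ : ∃ s, kids[k]? = some s := ⟨kids[k]'(by omega), List.getElem?_eq_getElem (by omega)⟩
          simp only [hsk] at hs
          exact ih s (setAt asg q k) p hs (agrees_setAt hag hk) hp
      | disj sd τ A B =>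
          simp only [coverTN, Bool.and_eq_true] at h
          obtain ⟨hA, hB⟩ := h
          obtain ⟨⟨⟨hb, hpr, hkb, hkp⟩, hle, hge⟩, hpo, hpn⟩ := hp
          rcases Classical.em (Present D sd τ) with hyes | hno
          · refine ih B asg _ hB hag ⟨⟨⟨hb, fun b hbm => ?_, hkb, hkp⟩, hle, hge⟩, hpo, hpn⟩
            rcases List.mem_cons.mp hbm with rfl | hbm
            · exact hyes
            · exact hpr b hbm
          · refine ih A asg _ hA hag ⟨⟨⟨fun b hbm => ?_, hpr, hkb, hkp⟩, hle, hge⟩, hpo, hpn⟩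
            rcases List.mem_cons.mp hbm with rfl | hbm
            · exact banned_of_not_present hno
            · exact hb b hbm
      | kdisj sd τ ℓ A B =>
          simp only [coverTN, Bool.and_eq_true] at h
          obtain ⟨hA, hB⟩ := h
          obtain ⟨⟨⟨hb, hpr, hkb, hkp⟩, hle, hge⟩, hpo, hpn⟩ := hp
          rcases Classical.em (KPresent D sd τ ℓ) with hyes | hno
          · refine ih B asg _ hB hag ⟨⟨⟨hb, hpr, hkb, fun b hbm => ?_⟩, hle, hge⟩, hpo, hpn⟩
            rcases List.mem_cons.mp hbm with rfl | hbm
            · exact hyes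
            · exact hkp b hbm
          · refine ih A asg _ hA hag ⟨⟨⟨hb, hpr, fun b hbm => ?_, hkp⟩, hle, hge⟩, hpo, hpn⟩
            rcases List.mem_cons.mp hbm with rfl | hbm
            · exact kbanned_of_not_kpresent hno
            · exact hkb b hbm
      | mdisj sd τ k A B =>
          simp only [coverTN, Bool.and_eq_true] at h
          obtain ⟨hA, hB⟩ := h
          obtain ⟨⟨hK, hle, hge⟩, hpo, hpn⟩ := hp
          rcases Classical.em (MassLE D sd τ k) with hyes | hno
          · refine ih A asg _ hA hag ⟨⟨hK, fun b hbm => ?_, hge⟩, hpo, hpn⟩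
            rcases List.mem_cons.mp hbm with rfl | hbm
            · exact hyes
            · exact hle b hbm
          · refine ih B asg _ hB hag ⟨⟨hK, hle, fun b hbm => ?_⟩, hpo, hpn⟩
            rcases List.mem_cons.mp hbm with rfl | hbm
            · exact massGE_of_not_massLE hno
            · exact hge b hbm
      | sdisj S A B =>
          simp only [coverTN, Bool.and_eq_true] at h
          obtain ⟨hA, hB⟩ := h
          obtain ⟨hpM, hpo, hpn⟩ := hp
          rcases Classical.em (SuppIn D S) with hyes | hno
          · refine ih A asg _ hA hag ⟨hpM, fun S' hS' => ?_, hpn⟩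
            rcases List.mem_cons.mp hS' with rfl | hS'
            · exact hyes
            · exact hpo S' hS'
          · refine ih B asg _ hB hag ⟨hpM, hpo, fun S' hS' => ?_⟩
            rcases List.mem_cons.mp hS' with rfl | hS'
            · exact outsideS_of_not_suppIn hno
            · exact hpn S' hS'

theorem rootCoverTN_sound (C : CertN) (D : Design) (t : CTreeN) (fuel : ℕ) (ks : List ℕ) (h : rootCoverTN C t fuel = true)
    (hlen : ks.length = C.vars.length) (hks : ∀ k ∈ ks, k < 5) (hk0 : ks.getD 0 0 ≠ 0) : LeafOrEFA C D ks := by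
  have hag0 : ((List.replicate C.vars.length (none : Option ℕ)).length = ks.length ∧ ∀ j m : ℕ,
      (List.replicate C.vars.length (none : Option ℕ))[j]? = some (some m) → ks[j]? = some m) := by
    exact ⟨by simp [hlen], fun _ _ h => absurd (List.eq_of_mem_replicate (List.mem_of_getElem? h)) (by simp)⟩
  have hp0 := NPath.nil_holds D
  cases t with
  | leaf i =>
      simp only [rootCoverTN] at h
      exact coverTN_sound C D ks hks _ _ _ _ h hag0 hp0
  | efa j =>
      simp only [rootCoverTN] at h
      exact coverTN_sound C D ks hks _ _ _ _ h hag0 hp0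
  | disj sd τ A B =>
      simp only [rootCoverTN] at h
      exact coverTN_sound C D ks hks _ _ _ _ h hag0 hp0
  | kdisj sd τ ℓ A B =>
      simp only [rootCoverTN] at h
      exact coverTN_sound C D ks hks _ _ _ _ h hag0 hp0
  | mdisj sd τ k A B =>
      simp only [rootCoverTN] at h
      exact coverTN_sound C D ks hks _ _ _ _ h hag0 hp0
  | sdisj S A B =>
      simp only [rootCoverTN] at h
      exact coverTN_sound C D ks hks _ _ _ _ h hag0 hp0
  | node q kids =>
      cases q with
      | succ q =>
          simp only [rootCoverTN] at h
          exact coverTN_sound C D ks hks _ _ _ _ h hag0 hp0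
      | zero =>
          simp only [rootCoverTN, Bool.and_eq_true, decide_eq_true_eq, List.all_eq_true, Bool.or_eq_true] at h
          obtain ⟨⟨hn, hlen5⟩, hall⟩ := h
          cases ks with
          | nil => simp at hlen; omega
          | cons a tl =>
              simp only [List.getD_cons_zero] at hk0
              have hk5 : a < 5 := hks a (by simp)
              have hs := hall a (List.mem_range.mpr hk5)
              rcases hs with hbad | hs
              · exact absurd hbad hk0
              obtain ⟨s, hsk⟩ : ∃ s, kids[a]? = some s := ⟨kids[a]'(by omega), List.getElem?_eq_getElem (by omega)⟩
              simp only [hsk] at hs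
              exact coverTN_sound C D (a :: tl) hks _ _ _ _ hs (agrees_setAt hag0 (k := a) (q := 0) rfl) hp0

/-! ## §30 (Δ6a) The end-to-end theorems («v1 + L1.5 + ℤ + S») and the chunked replay interface -/

theorem region_coverTN (C : CertN) (t : CTreeN) (fuel : ℕ) (hv : validTN C t fuel = true) (D : Design) (hA : D.OnAlphabet C.h) (h4 : D.A4)
    (c : Cell) (hc : c ∈ D.suppN ++ D.suppP) (f : Fin 4) (hfloor : (c f).a = 0) :
    (∃ lf ∈ C.leaves, InRegion C.vars lf.m.core.base D ∧
      (∀ sd : Side, ∀ c' ∈ suppSide D sd, admType C.h (allBounds C.vars lf.m.core.base) sd (typeOf c') = true) ∧ lf.LitsHold D) ∨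
    (∃ F ∈ C.fams, F.B = C.B ∧ SuppIn D F.supp ∧ Present D F.sd0 F.τ) := by
  have hv' := hv
  unfold validTN at hv'
  simp only [Bool.and_eq_true, decide_eq_true_eq] at hv'
  obtain ⟨⟨⟨hv0, hleaves⟩, _hfams⟩, hroot⟩ := hv'
  have hS1 := static_adm C.h D hA h4
  have hcP : c ∈ D.suppP := by
    rcases List.mem_append.mp hc with hcN | hcP
    · exfalso
      obtain ⟨x, hx, hlive⟩ := h4.2 c hcN
      have hlt := (hlive f).1
      have hx0 := (hA x (List.mem_append.mpr (Or.inr hx)) f).2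
      omega
    · exact hcP
  have hks5 : ∀ k ∈ C.vars.map (kOf D), k < 5 := fun k hk => by
    obtain ⟨v, _, rfl⟩ := List.mem_map.mp hk
    exact Nat.lt_succ_of_le (kOf_le_four D v)
  have hk0 : (C.vars.map (kOf D)).getD 0 0 ≠ 0 := by
    cases hvars : C.vars with
    | nil => rw [hvars] at hv0; simp at hv0
    | cons v0 rest =>
      rw [hvars] at hv0
      simp only [List.getElem?_cons_zero, Option.some.injEq] at hv0
      subst hv0
      simp only [List.map_cons, List.getD_cons_zero]
      have hcnt : 0 < (floorStat C.h).count (typeOf c) := by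
        unfold Stat.count
        refine List.length_pos_of_mem (List.mem_filter.mpr ⟨List.mem_finRange f, ?_⟩)
        refine List.elem_eq_true_of_mem (List.mem_filter.mpr ⟨by rw [admP0T_eq]; exact hS1.1 c hcP f, ?_⟩)
        simp [Shape.isFloor, shapeOf, typeOf, hfloor]
      have hle : (floorStat C.h).count (typeOf c) ≤ kOf D ⟨Side.P, floorStat C.h⟩ :=
        (isMax_kOf D ⟨Side.P, floorStat C.h⟩).1 c hcP
      omega
  rcases rootCoverTN_sound C D t fuel (C.vars.map (kOf D)) hroot (by simp) hks5 hk0 with ⟨lf, hlf, hmatch, hlits⟩ | hF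
  · have hreg : InRegion C.vars lf.m.core.base D := inRegion_of_matchesB C.vars lf.m.core.base D hmatch
    have hchk : checkLeafN C lf = true := List.all_eq_true.mp hleaves lf hlf
    exact Or.inl ⟨lf, hlf, hreg, adm_of_region C.toM.toB lf.m.core.base (hder_of_checkLeafN hchk) D hA h4 hreg, hlits⟩
  · exact Or.inr hF

/-- **SOUNDNESS: `validTN C t fuel ⇒ FloorFree h B rmin`** (`leafN_sound` ∕ `efaFam_sound`) -/
theorem floorFree_of_validTN (C : CertN) (t : CTreeN) (fuel : ℕ) (hv : validTN C t fuel = true) : FloorFreeH C.h C.B C.rmin := by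
  intro D hA h1 h4 _hμ hB hr c hc f
  by_contra hle
  have ha0 := (hA c hc f).2
  have hfloor : (c f).a = 0 := by omega
  have hlf2 : C.leaves.all (fun lf => checkLeafN C lf) = true ∧ C.fams.all validEFAFam = true := by
    have hv' := hv
    unfold validTN at hv'
    simp only [Bool.and_eq_true] at hv'
    exact ⟨hv'.1.1.2, hv'.1.2⟩
  have hsides : D.suppN ≠ [] ∧ D.suppP ≠ [] := by
    rcases List.mem_append.mp hc with hcN | hcP
    · obtain ⟨x, hx, _⟩ := h4.2 c hcN
      exact ⟨List.ne_nil_of_mem hcN, List.ne_nil_of_mem hx⟩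
    · obtain ⟨y, hy, _⟩ := h4.1 c hcP
      exact ⟨List.ne_nil_of_mem hy, List.ne_nil_of_mem hcP⟩
  rcases region_coverTN C t fuel hv D hA h4 c hc f hfloor with ⟨lf, hlf, hreg, hadm, hlits⟩ | ⟨F, hF, hFB, hS, hpres⟩
  · have hchk : checkLeafN C lf = true := List.all_eq_true.mp hlf2.1 lf hlf
    exact leafN_sound C lf hchk D h1 h4 hB hr hsides.1 hsides.2 hreg hadm hlits
      (fun e _ k _ _ he => parity_even C.toM.toB lf.m.core.base e.1 k e.2.par he D h1 hadm)
  · have hval : validEFAFam F = true := List.all_eq_true.mp hlf2.2 F hF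
    exact efaFam_sound F hval D h1 (by rw [hFB]; exact hB) hS hpres

/-- **PER-REGION SOUNDNESS** (one cap region — NOT `FloorFree`) -/
theorem regionEmpty_of_validRN (C : CertN) (t : CTreeN) (fuel : ℕ) (caps : List (Option ℕ)) (hv : validRN C t fuel caps = true)
    (D : Design) (hA : D.OnAlphabet C.h) (h1 : D.A1) (h4 : D.A4) (hB : D.copies ≤ C.B) (hr : C.rmin ≤ D.rank) (hN : D.suppN ≠ [])
    (hcaps : InCaps C.vars caps D) : False := by
  have hv' := hv
  unfold validRN at hv'
  simp only [Bool.and_eq_true, decide_eq_true_eq] at hv'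
  obtain ⟨⟨⟨hlen, hleaves⟩, hfams⟩, hcov⟩ := hv'
  have hP : D.suppP ≠ [] := by
    obtain ⟨y, hy⟩ := List.exists_mem_of_ne_nil _ hN
    obtain ⟨x, hx, _⟩ := h4.2 y hy
    exact List.ne_nil_of_mem hx
  have hks5 : ∀ k ∈ C.vars.map (kOf D), k < 5 := fun k hk => by
    obtain ⟨v, _, rfl⟩ := List.mem_map.mp hk
    exact Nat.lt_succ_of_le (kOf_le_four D v)
  have hag : caps.length = (C.vars.map (kOf D)).length ∧
      ∀ j m : ℕ, caps[j]? = some (some m) → (C.vars.map (kOf D))[j]? = some m := by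
    refine ⟨by simp [hlen], fun j m hj => ?_⟩
    obtain ⟨hjl, _⟩ := List.getElem?_eq_some_iff.mp hj
    obtain ⟨v, hvj⟩ : ∃ v, C.vars[j]? = some v := ⟨C.vars[j]'(by omega), List.getElem?_eq_getElem (by omega)⟩
    have hz : (List.zip C.vars caps)[j]? = some (v, some m) := List.getElem?_zip_eq_some.mpr ⟨hvj, hj⟩
    have hmax := hcaps _ (List.mem_of_getElem? hz) m rfl
    rw [List.getElem?_map, hvj]
    exact congrArg some (isMax_unique (isMax_kOf D v) hmax)
  rcases coverTN_sound C D (C.vars.map (kOf D)) hks5 fuel t caps NPath.nil hcov hag (NPath.nil_holds D) with ⟨lf, hlf, hmatch, hlits⟩ | ⟨F, hF, hFB, hS, hpres⟩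
  · have hreg : InRegion C.vars lf.m.core.base D := inRegion_of_matchesB C.vars lf.m.core.base D hmatch
    have hchk : checkLeafN C lf = true := List.all_eq_true.mp hleaves lf hlf
    have hadm := adm_of_region C.toM.toB lf.m.core.base (hder_of_checkLeafN hchk) D hA h4 hreg
    exact leafN_sound C lf hchk D h1 h4 hB hr hN hP hreg hadm hlits
      (fun e _ k _ _ he => parity_even C.toM.toB lf.m.core.base e.1 k e.2.par he D h1 hadm)
  · have hval : validEFAFam F = true := List.all_eq_true.mp hfams F hF
    exact efaFam_sound F hval D h1 (by rw [hFB]; exact hB) hS hpres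

theorem regionEmpty_of_validRN' (C : CertN) (t : CTreeN) (fuel : ℕ) (caps : List (Option ℕ)) (hv : validRN C t fuel caps = true)
    (hpos : 0 < C.rmin) (D : Design) (hA : D.OnAlphabet C.h) (h1 : D.A1) (h4 : D.A4) (hB : D.copies ≤ C.B) (hr : C.rmin ≤ D.rank)
    (hcaps : InCaps C.vars caps D) : False :=
  regionEmpty_of_validRN C t fuel caps hv D hA h1 h4 hB hr (suppN_ne_nil_of_rank D C.rmin hr hpos) hcaps

theorem validTN_intro (C : CertN) (t : CTreeN) (fuel : ℕ) (h0 : C.vars[0]? = some ⟨Side.P, floorStat C.h⟩)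
    (hl : ∀ lf ∈ C.leaves, checkLeafN C lf = true) (hf : ∀ F ∈ C.fams, validEFAFam F = true) (hc : rootCoverTN C t fuel = true) :
    validTN C t fuel = true := by
  unfold validTN
  simp only [Bool.and_eq_true, decide_eq_true_eq, List.all_eq_true]
  exact ⟨⟨⟨h0, hl⟩, hf⟩, hc⟩

theorem validRN_intro (C : CertN) (t : CTreeN) (fuel : ℕ) (caps : List (Option ℕ)) (h0 : caps.length = C.vars.length)
    (hl : ∀ lf ∈ C.leaves, checkLeafN C lf = true) (hf : ∀ F ∈ C.fams, validEFAFam F = true) (hc : coverTN C t fuel caps NPath.nil = true) :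
    validRN C t fuel caps = true := by
  unfold validRN
  simp only [Bool.and_eq_true, decide_eq_true_eq, List.all_eq_true]
  exact ⟨⟨⟨h0, hl⟩, hf⟩, hc⟩

/-- **end theorem from chunks**: LP-leaf lemmas + EFA-family lemmas + structural cover ⇒ `FloorFreeH` -/
theorem floorFree_of_chunksN (C : CertN) (t : CTreeN) (fuel : ℕ) (h0 : C.vars[0]? = some ⟨Side.P, floorStat C.h⟩)
    (hl : ∀ lf ∈ C.leaves, checkLeafN C lf = true) (hf : ∀ F ∈ C.fams, validEFAFam F = true) (hc : rootCoverTN C t fuel = true) :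
    FloorFreeH C.h C.B C.rmin :=
  floorFree_of_validTN C t fuel (validTN_intro C t fuel h0 hl hf hc)

/-- **region-level end theorem from chunks** («v1 + L1.5 + ℤ + S») -/
theorem regionEmpty_of_chunksN (C : CertN) (t : CTreeN) (fuel : ℕ) (caps : List (Option ℕ)) (h0 : caps.length = C.vars.length)
    (hl : ∀ lf ∈ C.leaves, checkLeafN C lf = true) (hf : ∀ F ∈ C.fams, validEFAFam F = true) (hc : coverTN C t fuel caps NPath.nil = true)
    (D : Design) (hA : D.OnAlphabet C.h) (h1 : D.A1) (h4 : D.A4) (hB : D.copies ≤ C.B) (hr : C.rmin ≤ D.rank) (hN : D.suppN ≠ [])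
    (hcaps : InCaps C.vars caps D) : False :=
  regionEmpty_of_validRN C t fuel caps (validRN_intro C t fuel caps h0 hl hf hc) D hA h1 h4 hB hr hN hcaps

/-! ## §31 (Δ6a) Smoke tests (FAKE data): path discipline of `sdisj` ∕ `efa` -/
section SmokeN

def fakeLeafN (caps : List (Option ℕ)) (pres : List Pres) (ngs : List NoGood) : LeafN := ⟨fakeLeafM caps pres [] [] [], ngs⟩

/-- fake family: a5 support, m³b anchor, NO certs (invalid; cover discipline only) -/
def fakeFam : EFAFam := ⟨199, efa4273a5S, Side.P, ![⟨0, 3, 3⟩, ⟨0, 3, 3⟩, ⟨0, 3, 3⟩, ⟨2, 2, 2⟩], []⟩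

/-- FLOOR = 2: `disj` on the anchor class; present side: `sdisj efa4273a5S` (inside: EFA leaf; outside: LP leaf with no-good `(S, 3)`) -/
def fakeCN : CertN :=
  {h := 6, B := 199, rmin := 8, vars := [⟨Side.P, floorStat 6⟩],
   leaves := [fakeLeafN [some 1] [] [], fakeLeafN [some 2] [] [],
              fakeLeafN [some 2] [⟨Side.P, ![⟨0, 3, 3⟩, ⟨0, 3, 3⟩, ⟨0, 3, 3⟩, ⟨2, 2, 2⟩], 0, 7⟩] [⟨efa4273a5S, 3⟩],
              fakeLeafN [some 3] [] [], fakeLeafN [some 4] [] []],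
   fams := [fakeFam]}

def fakeTN : CTreeN :=
  .node 0 [.leaf 0, .leaf 0,
    .disj Side.P ![⟨0, 3, 3⟩, ⟨0, 3, 3⟩, ⟨0, 3, 3⟩, ⟨2, 2, 2⟩] (.leaf 1) (.sdisj efa4273a5S (.efa 0) (.leaf 2)), .leaf 3, .leaf 4]

example : rootCoverTN fakeCN fakeTN 3 = true := by decide
/-- the EFA leaf outside any `sdisj` (no `only` literal on its path) is rejected -/
example : rootCoverTN fakeCN (.node 0 [.leaf 0, .leaf 0,
    .disj Side.P ![⟨0, 3, 3⟩, ⟨0, 3, 3⟩, ⟨0, 3, 3⟩, ⟨2, 2, 2⟩] (.leaf 1) (.efa 0), .leaf 3, .leaf 4]) 3 = false := by decide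
/-- the EFA leaf on the ABSENT side of its anchor's branch is rejected -/
example : rootCoverTN fakeCN (.node 0 [.leaf 0, .leaf 0,
    .disj Side.P ![⟨0, 3, 3⟩, ⟨0, 3, 3⟩, ⟨0, 3, 3⟩, ⟨2, 2, 2⟩] (.sdisj efa4273a5S (.efa 0) (.leaf 2)) (.leaf 1), .leaf 3, .leaf 4]) 3 = false := by
  decide
/-- the children of the support disjunction swapped (no-good leaf on the inside, EFA leaf on the outside) is rejected -/
example : rootCoverTN fakeCN (.node 0 [.leaf 0, .leaf 0,
    .disj Side.P ![⟨0, 3, 3⟩, ⟨0, 3, 3⟩, ⟨0, 3, 3⟩, ⟨2, 2, 2⟩] (.leaf 1) (.sdisj efa4273a5S (.leaf 2) (.efa 0)), .leaf 3, .leaf 4]) 3 = false := by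
  decide
/-- `ngPay`: `Z` off `S`, `0` on a slot permutation of an entry (side-matched), `Z` on the other side -/
example : ngPay [⟨efa4273a5S, 3⟩] Side.P τ0 = 3 := by decide
example : ngPay [⟨efa4273a5S, 3⟩] Side.P ![⟨2, 2, 2⟩, ⟨0, 3, 3⟩, ⟨0, 3, 3⟩, ⟨0, 3, 3⟩] = 0 := by decide
example : ngPay [⟨efa4273a5S, 3⟩] Side.N ![⟨2, 2, 2⟩, ⟨0, 3, 3⟩, ⟨0, 3, 3⟩, ⟨0, 3, 3⟩] = 3 := by decide
/-- the fake family is NOT valid — `validTN` would reject the certificate -/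
example : validEFAFam fakeFam = false := by decide

end SmokeN

/-! ## §32 Two more EFA leaf supports replayed — anomaly g13's a6 (4273 support, anchor P f²rb; `leaf4273x-efreeanchor-a6.json` d36374722ecf3f70,
bound 2374421∕3278 ≈ 724.35) and 3831-a4 (`leaf3831.json` e387c7f18fb66880, anchor P m³(1;3,2); `leaf3831-efreeanchor-a4.json` f3af15ec40b87ec6, bound
6091570529∕25275872 ≈ 241.00); replica PASS to the digit. ONE LEAF SUPPORT with an ORDERED anchor each — no region, no floor, nothing toward `FloorFree 6 199 8`. -/
section EFAMore

def efa4273a6S : List (Side × STuple) :=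
  [(Side.N, ![⟨2, 2, 2⟩, ⟨2, 2, 2⟩, ⟨2, 2, 2⟩, ⟨4, 1, 1⟩]),
   (Side.N, ![⟨2, 2, 2⟩, ⟨2, 2, 2⟩, ⟨6, 0, 0⟩, ⟨6, 0, 0⟩]),
   (Side.N, ![⟨2, 2, 2⟩, ⟨6, 0, 0⟩, ⟨6, 0, 0⟩, ⟨6, 0, 0⟩]),
   (Side.N, ![⟨2, 4, 0⟩, ⟨2, 4, 0⟩, ⟨4, 2, 0⟩, ⟨5, 1, 0⟩]),
   (Side.N, ![⟨5, 1, 0⟩, ⟨6, 0, 0⟩, ⟨6, 0, 0⟩, ⟨6, 0, 0⟩]),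
   (Side.P, ![⟨0, 3, 3⟩, ⟨0, 3, 3⟩, ⟨0, 3, 3⟩, ⟨2, 2, 2⟩]),
   (Side.P, ![⟨0, 5, 1⟩, ⟨0, 5, 1⟩, ⟨2, 3, 1⟩, ⟨2, 2, 2⟩]),
   (Side.P, ![⟨0, 5, 1⟩, ⟨2, 3, 1⟩, ⟨4, 1, 1⟩, ⟨4, 1, 1⟩]),
   (Side.P, ![⟨1, 4, 1⟩, ⟨2, 3, 1⟩, ⟨4, 1, 1⟩, ⟨4, 1, 1⟩])]

def efa4273a6Rows : List ERow :=
  [⟨![Fil.one, Fil.one, Fil.h, Fil.one], ![Fil.one, Fil.one, Fil.one, Fil.h], -452883632036003285044574878091115840⟩,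
   ⟨![Fil.one, Fil.h, Fil.one, Fil.one], ![Fil.one, Fil.one, Fil.one, Fil.h], -241289997571322073283273444147373280⟩,
   ⟨![Fil.one, Fil.one, Fil.pt, Fil.one], ![Fil.one, Fil.one, Fil.one, Fil.pt], -73871558966439156904818953478045840⟩,
   ⟨![Fil.h, Fil.one, Fil.one, Fil.h], ![Fil.one, Fil.one, Fil.one, Fil.pt], -152345738220515436328898164060707216⟩,
   ⟨![Fil.h, Fil.h, Fil.one, Fil.one], ![Fil.one, Fil.one, Fil.one, Fil.pt], 374184645945839962757770269099853296⟩,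
   ⟨![Fil.one, Fil.one, Fil.pt, Fil.h], ![Fil.one, Fil.one, Fil.h, Fil.pt], 84396691846789782387629653415842560⟩,
   ⟨![Fil.one, Fil.h, Fil.one, Fil.pt], ![Fil.one, Fil.one, Fil.h, Fil.pt], 12283299943709963270917604493534480⟩,
   ⟨![Fil.h, Fil.one, Fil.one, Fil.pt], ![Fil.one, Fil.one, Fil.h, Fil.pt], 67617047698593968802193055044679880⟩,
   ⟨![Fil.h, Fil.h, Fil.one, Fil.h], ![Fil.one, Fil.one, Fil.h, Fil.pt], -184538883895254842186157346508411520⟩,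
   ⟨![Fil.pt, Fil.one, Fil.h, Fil.one], ![Fil.one, Fil.one, Fil.h, Fil.pt], -3102522106869580793621689433843460⟩,
   ⟨![Fil.one, Fil.h, Fil.h, Fil.pt], ![Fil.one, Fil.one, Fil.pt, Fil.pt], -17732140494280440690974949546483480⟩,
   ⟨![Fil.one, Fil.h, Fil.pt, Fil.h], ![Fil.one, Fil.one, Fil.pt, Fil.pt], -16044142495258333770348328681156380⟩,
   ⟨![Fil.one, Fil.pt, Fil.h, Fil.h], ![Fil.one, Fil.one, Fil.pt, Fil.pt], 24577322645645118649902440258983500⟩,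
   ⟨![Fil.one, Fil.pt, Fil.pt, Fil.one], ![Fil.one, Fil.one, Fil.pt, Fil.pt], 25144531828090683770647555752546360⟩,
   ⟨![Fil.h, Fil.one, Fil.h, Fil.pt], ![Fil.one, Fil.one, Fil.pt, Fil.pt], -22550205566800066872206620320750924⟩,
   ⟨![Fil.h, Fil.h, Fil.one, Fil.pt], ![Fil.one, Fil.one, Fil.pt, Fil.pt], 33214081443592674287860264236221340⟩,
   ⟨![Fil.h, Fil.h, Fil.h, Fil.h], ![Fil.one, Fil.one, Fil.pt, Fil.pt], 38358131781006373527385723786668840⟩,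
   ⟨![Fil.h, Fil.pt, Fil.one, Fil.h], ![Fil.one, Fil.one, Fil.pt, Fil.pt], -14427192627212996222989476668496780⟩,
   ⟨![Fil.h, Fil.pt, Fil.h, Fil.one], ![Fil.one, Fil.one, Fil.pt, Fil.pt], -10209829382110122978763577434818216⟩,
   ⟨![Fil.pt, Fil.one, Fil.one, Fil.pt], ![Fil.one, Fil.one, Fil.pt, Fil.pt], -11514567454254759886687517379175800⟩,
   ⟨![Fil.pt, Fil.one, Fil.pt, Fil.one], ![Fil.one, Fil.one, Fil.pt, Fil.pt], 18489569299081170982501329448106490⟩,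
   ⟨![Fil.pt, Fil.h, Fil.one, Fil.h], ![Fil.one, Fil.one, Fil.pt, Fil.pt], 6061154790654075155559084231177060⟩,
   ⟨![Fil.pt, Fil.pt, Fil.one, Fil.one], ![Fil.one, Fil.one, Fil.pt, Fil.pt], -33224495857027267971012664267084140⟩,
   ⟨![Fil.one, Fil.pt, Fil.h, Fil.pt], ![Fil.one, Fil.h, Fil.pt, Fil.pt], -2076441736084375238752860107142930⟩,
   ⟨![Fil.one, Fil.pt, Fil.pt, Fil.h], ![Fil.one, Fil.h, Fil.pt, Fil.pt], -8290874574865800706659845412858080⟩,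
   ⟨![Fil.h, Fil.one, Fil.pt, Fil.pt], ![Fil.one, Fil.h, Fil.pt, Fil.pt], 7643845417111496914045047633901030⟩,
   ⟨![Fil.h, Fil.h, Fil.h, Fil.pt], ![Fil.one, Fil.h, Fil.pt, Fil.pt], -2623568378194390419982836033993710⟩,
   ⟨![Fil.h, Fil.h, Fil.pt, Fil.h], ![Fil.one, Fil.h, Fil.pt, Fil.pt], -3277479706695503701540242534203010⟩,
   ⟨![Fil.h, Fil.pt, Fil.one, Fil.pt], ![Fil.one, Fil.h, Fil.pt, Fil.pt], -296107340386859919733725515970000⟩,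
   ⟨![Fil.h, Fil.pt, Fil.h, Fil.h], ![Fil.one, Fil.h, Fil.pt, Fil.pt], -956441983893335088979682619918970⟩,
   ⟨![Fil.h, Fil.pt, Fil.pt, Fil.one], ![Fil.one, Fil.h, Fil.pt, Fil.pt], -10950465362639026401916731068899600⟩,
   ⟨![Fil.pt, Fil.one, Fil.h, Fil.pt], ![Fil.one, Fil.h, Fil.pt, Fil.pt], 2088048403615921795286374726199560⟩,
   ⟨![Fil.pt, Fil.one, Fil.pt, Fil.h], ![Fil.one, Fil.h, Fil.pt, Fil.pt], -5876135479226384064612580630035430⟩,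
   ⟨![Fil.pt, Fil.h, Fil.one, Fil.pt], ![Fil.one, Fil.h, Fil.pt, Fil.pt], 2183279341103461251214558294471940⟩,
   ⟨![Fil.pt, Fil.h, Fil.h, Fil.h], ![Fil.one, Fil.h, Fil.pt, Fil.pt], -1986115550962270373320563868381350⟩,
   ⟨![Fil.pt, Fil.h, Fil.pt, Fil.one], ![Fil.one, Fil.h, Fil.pt, Fil.pt], -8211936431055184671512195727542810⟩,
   ⟨![Fil.pt, Fil.pt, Fil.one, Fil.h], ![Fil.one, Fil.h, Fil.pt, Fil.pt], 10574917102719708599925681523687480⟩,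
   ⟨![Fil.pt, Fil.pt, Fil.h, Fil.one], ![Fil.one, Fil.h, Fil.pt, Fil.pt], 16216062093892158698417108169448610⟩,
   ⟨![Fil.h, Fil.h, Fil.pt, Fil.pt], ![Fil.one, Fil.pt, Fil.pt, Fil.pt], -1443376431992989406815013391372386⟩,
   ⟨![Fil.h, Fil.pt, Fil.h, Fil.pt], ![Fil.one, Fil.pt, Fil.pt, Fil.pt], 444718479035908511652339854812560⟩,
   ⟨![Fil.h, Fil.pt, Fil.pt, Fil.h], ![Fil.one, Fil.pt, Fil.pt, Fil.pt], 3773586432942422137936996700405516⟩,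
   ⟨![Fil.pt, Fil.one, Fil.pt, Fil.pt], ![Fil.one, Fil.pt, Fil.pt, Fil.pt], -190383923380410312374328274673490⟩,
   ⟨![Fil.pt, Fil.h, Fil.h, Fil.pt], ![Fil.one, Fil.pt, Fil.pt, Fil.pt], -552085619826431778406393026687350⟩,
   ⟨![Fil.pt, Fil.h, Fil.pt, Fil.h], ![Fil.one, Fil.pt, Fil.pt, Fil.pt], 2863230302233133583349507203015240⟩,
   ⟨![Fil.pt, Fil.pt, Fil.one, Fil.pt], ![Fil.one, Fil.pt, Fil.pt, Fil.pt], -1154635206929652765658306480155810⟩,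
   ⟨![Fil.pt, Fil.pt, Fil.h, Fil.h], ![Fil.one, Fil.pt, Fil.pt, Fil.pt], -4584958209090233957137035112577860⟩,
   ⟨![Fil.pt, Fil.pt, Fil.pt, Fil.one], ![Fil.one, Fil.pt, Fil.pt, Fil.pt], 357297846770558179644547385953515⟩,
   ⟨![Fil.pt, Fil.h, Fil.pt, Fil.pt], ![Fil.h, Fil.pt, Fil.pt, Fil.pt], -33304424791074695174185062903850⟩,
   ⟨![Fil.pt, Fil.pt, Fil.h, Fil.pt], ![Fil.h, Fil.pt, Fil.pt, Fil.pt], 422113989199341389134466385180480⟩,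
   ⟨![Fil.pt, Fil.pt, Fil.pt, Fil.h], ![Fil.h, Fil.pt, Fil.pt, Fil.pt], -165734988906522532389860808704045⟩]

def efa4273a6 : EFACert := ⟨199, efa4273a6S, Side.P, ![⟨0, 5, 1⟩, ⟨0, 5, 1⟩, ⟨2, 3, 1⟩, ⟨2, 2, 2⟩], efa4273a6Rows, 754004974704578681077375844267520⟩


def efa3831a4S : List (Side × STuple) :=
  [(Side.N, ![⟨2, 2, 2⟩, ⟨2, 2, 2⟩, ⟨2, 2, 2⟩, ⟨3, 2, 1⟩]),
   (Side.N, ![⟨2, 4, 0⟩, ⟨2, 4, 0⟩, ⟨2, 4, 0⟩, ⟨6, 0, 0⟩]),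
   (Side.N, ![⟨2, 4, 0⟩, ⟨3, 3, 0⟩, ⟨3, 3, 0⟩, ⟨4, 2, 0⟩]),
   (Side.N, ![⟨2, 4, 0⟩, ⟨5, 1, 0⟩, ⟨6, 0, 0⟩, ⟨6, 0, 0⟩]),
   (Side.P, ![⟨0, 3, 3⟩, ⟨0, 3, 3⟩, ⟨0, 3, 3⟩, ⟨1, 3, 2⟩]),
   (Side.P, ![⟨0, 5, 1⟩, ⟨0, 5, 1⟩, ⟨0, 5, 1⟩, ⟨4, 1, 1⟩]),
   (Side.P, ![⟨0, 5, 1⟩, ⟨0, 5, 1⟩, ⟨2, 2, 2⟩, ⟨4, 1, 1⟩]),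
   (Side.P, ![⟨0, 5, 1⟩, ⟨0, 5, 1⟩, ⟨4, 1, 1⟩, ⟨4, 1, 1⟩]),
   (Side.P, ![⟨0, 5, 1⟩, ⟨1, 4, 1⟩, ⟨1, 4, 1⟩, ⟨2, 3, 1⟩])]

def efa3831a4Rows : List ERow :=
  [⟨![Fil.one, Fil.one, Fil.h, Fil.one], ![Fil.one, Fil.one, Fil.one, Fil.h], 33839943641614052952500826556416⟩,
   ⟨![Fil.h, Fil.one, Fil.one, Fil.one], ![Fil.one, Fil.one, Fil.one, Fil.h], 12512756728746639620177930661888⟩,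
   ⟨![Fil.h, Fil.one, Fil.one, Fil.h], ![Fil.one, Fil.one, Fil.one, Fil.pt], 1344411351382174016211449891712⟩,
   ⟨![Fil.h, Fil.h, Fil.one, Fil.one], ![Fil.one, Fil.one, Fil.one, Fil.pt], 14692576742596188749712491883648⟩,
   ⟨![Fil.one, Fil.one, Fil.pt, Fil.h], ![Fil.one, Fil.one, Fil.h, Fil.pt], -6375316624781262836054766189372⟩,
   ⟨![Fil.one, Fil.h, Fil.one, Fil.pt], ![Fil.one, Fil.one, Fil.h, Fil.pt], -3525402263328524310740933144220⟩,
   ⟨![Fil.one, Fil.h, Fil.pt, Fil.one], ![Fil.one, Fil.one, Fil.h, Fil.pt], 18886031023432029846475651173180⟩,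
   ⟨![Fil.one, Fil.pt, Fil.one, Fil.h], ![Fil.one, Fil.one, Fil.h, Fil.pt], 261392268959665384255021731996⟩,
   ⟨![Fil.h, Fil.one, Fil.one, Fil.pt], ![Fil.one, Fil.one, Fil.h, Fil.pt], 17343548693069922298376463808512⟩,
   ⟨![Fil.h, Fil.h, Fil.h, Fil.one], ![Fil.one, Fil.one, Fil.h, Fil.pt], -11801475829652220148909584752640⟩,
   ⟨![Fil.pt, Fil.one, Fil.h, Fil.one], ![Fil.one, Fil.one, Fil.h, Fil.pt], -11740975231240350508496534111232⟩,
   ⟨![Fil.one, Fil.pt, Fil.pt, Fil.one], ![Fil.one, Fil.one, Fil.pt, Fil.pt], -2447709308472261082860749205210⟩,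
   ⟨![Fil.h, Fil.h, Fil.h, Fil.h], ![Fil.one, Fil.one, Fil.pt, Fil.pt], 2158686282283767217088727459840⟩,
   ⟨![Fil.h, Fil.h, Fil.pt, Fil.one], ![Fil.one, Fil.one, Fil.pt, Fil.pt], -8926736526237366974973193901568⟩,
   ⟨![Fil.pt, Fil.one, Fil.one, Fil.pt], ![Fil.one, Fil.one, Fil.pt, Fil.pt], -2546449683166950533841103223040⟩,
   ⟨![Fil.pt, Fil.one, Fil.h, Fil.h], ![Fil.one, Fil.one, Fil.pt, Fil.pt], 3737475255397543816219401416364⟩,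
   ⟨![Fil.pt, Fil.h, Fil.one, Fil.h], ![Fil.one, Fil.one, Fil.pt, Fil.pt], -7148600313770762661540505747968⟩,
   ⟨![Fil.pt, Fil.h, Fil.h, Fil.one], ![Fil.one, Fil.one, Fil.pt, Fil.pt], 11247972333022027464956929690452⟩,
   ⟨![Fil.one, Fil.pt, Fil.h, Fil.pt], ![Fil.one, Fil.h, Fil.pt, Fil.pt], -403824692663338657643021477760⟩,
   ⟨![Fil.one, Fil.pt, Fil.pt, Fil.h], ![Fil.one, Fil.h, Fil.pt, Fil.pt], 775535906228858788849521008058⟩,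
   ⟨![Fil.h, Fil.one, Fil.pt, Fil.pt], ![Fil.one, Fil.h, Fil.pt, Fil.pt], -1092027194123954209842453580046⟩,
   ⟨![Fil.h, Fil.h, Fil.h, Fil.pt], ![Fil.one, Fil.h, Fil.pt, Fil.pt], -652649093689045466066697561060⟩,
   ⟨![Fil.h, Fil.h, Fil.pt, Fil.h], ![Fil.one, Fil.h, Fil.pt, Fil.pt], 1628351647118566889034519866880⟩,
   ⟨![Fil.h, Fil.pt, Fil.one, Fil.pt], ![Fil.one, Fil.h, Fil.pt, Fil.pt], 844893651567211921419321093504⟩,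
   ⟨![Fil.h, Fil.pt, Fil.h, Fil.h], ![Fil.one, Fil.h, Fil.pt, Fil.pt], -17789509520107456804278013980⟩,
   ⟨![Fil.h, Fil.pt, Fil.pt, Fil.one], ![Fil.one, Fil.h, Fil.pt, Fil.pt], 503557581731488958338435667342⟩,
   ⟨![Fil.pt, Fil.one, Fil.h, Fil.pt], ![Fil.one, Fil.h, Fil.pt, Fil.pt], 129723346668904659872422200508⟩,
   ⟨![Fil.pt, Fil.one, Fil.pt, Fil.h], ![Fil.one, Fil.h, Fil.pt, Fil.pt], -170224014212414472203381925338⟩,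
   ⟨![Fil.pt, Fil.h, Fil.one, Fil.pt], ![Fil.one, Fil.h, Fil.pt, Fil.pt], 1040155411161581990327327673210⟩,
   ⟨![Fil.pt, Fil.h, Fil.h, Fil.h], ![Fil.one, Fil.h, Fil.pt, Fil.pt], -1347543418278638075478430510080⟩,
   ⟨![Fil.pt, Fil.h, Fil.pt, Fil.one], ![Fil.one, Fil.h, Fil.pt, Fil.pt], 307026728381180576807000856410⟩,
   ⟨![Fil.pt, Fil.pt, Fil.one, Fil.h], ![Fil.one, Fil.h, Fil.pt, Fil.pt], 531311424202233505142546241030⟩,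
   ⟨![Fil.pt, Fil.pt, Fil.h, Fil.one], ![Fil.one, Fil.h, Fil.pt, Fil.pt], -920994138871919929379060747068⟩,
   ⟨![Fil.h, Fil.h, Fil.pt, Fil.pt], ![Fil.one, Fil.pt, Fil.pt, Fil.pt], 304003273792100686651573916734⟩,
   ⟨![Fil.h, Fil.pt, Fil.h, Fil.pt], ![Fil.one, Fil.pt, Fil.pt, Fil.pt], -75895681022892603332221766400⟩,
   ⟨![Fil.h, Fil.pt, Fil.pt, Fil.h], ![Fil.one, Fil.pt, Fil.pt, Fil.pt], -203162722627616607176816259262⟩,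
   ⟨![Fil.pt, Fil.one, Fil.pt, Fil.pt], ![Fil.one, Fil.pt, Fil.pt, Fil.pt], 74872416541976680909496828185⟩,
   ⟨![Fil.pt, Fil.h, Fil.h, Fil.pt], ![Fil.one, Fil.pt, Fil.pt, Fil.pt], -22175210431493274264323135498⟩,
   ⟨![Fil.pt, Fil.h, Fil.pt, Fil.h], ![Fil.one, Fil.pt, Fil.pt, Fil.pt], -116233048339929123674800215168⟩,
   ⟨![Fil.pt, Fil.pt, Fil.one, Fil.pt], ![Fil.one, Fil.pt, Fil.pt, Fil.pt], -198150542159499159811689256320⟩,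
   ⟨![Fil.pt, Fil.pt, Fil.h, Fil.h], ![Fil.one, Fil.pt, Fil.pt, Fil.pt], 130817010458853090104658575114⟩,
   ⟨![Fil.pt, Fil.pt, Fil.pt, Fil.one], ![Fil.one, Fil.pt, Fil.pt, Fil.pt], 25620013250473250520687379175⟩,
   ⟨![Fil.pt, Fil.h, Fil.pt, Fil.pt], ![Fil.h, Fil.pt, Fil.pt, Fil.pt], -14613763075131314413699354975⟩,
   ⟨![Fil.pt, Fil.pt, Fil.h, Fil.pt], ![Fil.h, Fil.pt, Fil.pt, Fil.pt], 25515184067226444969939361152⟩,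
   ⟨![Fil.pt, Fil.pt, Fil.pt, Fil.h], ![Fil.h, Fil.pt, Fil.pt, Fil.pt], 4072122603986829595808366047⟩]

def efa3831a4 : EFACert := ⟨199, efa3831a4S, Side.P, ![⟨0, 3, 3⟩, ⟨0, 3, 3⟩, ⟨0, 3, 3⟩, ⟨1, 3, 2⟩], efa3831a4Rows, 512959207836947258239339069440⟩


theorem efa4273a6_valid : validEFA efa4273a6 = true := by decide +kernel

/-- **4273's L1-terminal support cannot carry an (A1)-clean design of ≤ 199 copies with a P-cell of ordered type f²rb as listed** -/
theorem efa4273a6_kills (D : Design) (h1 : D.A1) (hB : D.copies ≤ 199) (hS : SuppIn D efa4273a6S)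
    (hp : OPresent D Side.P ![⟨0, 5, 1⟩, ⟨0, 5, 1⟩, ⟨2, 3, 1⟩, ⟨2, 2, 2⟩]) : False :=
  efa_sound efa4273a6 efa4273a6_valid D h1 hB hS hp

theorem efa3831a4_valid : validEFA efa3831a4 = true := by decide +kernel

/-- **3831's L1-terminal support cannot carry an (A1)-clean design of ≤ 199 copies with a P-cell of ordered type m³(1;3,2) as listed** -/
theorem efa3831a4_kills (D : Design) (h1 : D.A1) (hB : D.copies ≤ 199) (hS : SuppIn D efa3831a4S)
    (hp : OPresent D Side.P ![⟨0, 3, 3⟩, ⟨0, 3, 3⟩, ⟨0, 3, 3⟩, ⟨1, 3, 2⟩]) : False :=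
  efa_sound efa3831a4 efa3831a4_valid D h1 hB hS hp

end EFAMore

/-! ## §33 (Δ6b groundwork) slot swaps in the FIRST argument of `anyRel` ∕ `sameM` — what an ORDERED pointwise check (ordered e-free rows inside a
region leaf, instrument (i) «OT-L1») needs to pass from sorted representatives to all supported cells; the ordered leaf itself is module-2 work. -/

/-- the 24-list is closed under LEFT composition with each adjacent swap -/
theorem perms4_closedL01 : ∀ p ∈ perms4, ∃ q ∈ perms4, ∀ f : Fin 4, q f = sw01 (p f) := by decide +kernel
theorem perms4_closedL12 : ∀ p ∈ perms4, ∃ q ∈ perms4, ∀ f : Fin 4, q f = sw12 (p f) := by decide +kernel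
theorem perms4_closedL23 : ∀ p ∈ perms4, ∃ q ∈ perms4, ∀ f : Fin 4, q f = sw23 (p f) := by decide +kernel

/-- `anyRel` is invariant under an involutive slot permutation of the REFERENCE type under which the 24-list is left-closed -/
theorem anyRel_compL (R : Shape → Shape → Bool) (τ t : STuple) (s : Fin 4 → Fin 4) (hs : ∀ f, s (s f) = f)
    (hc : ∀ p ∈ perms4, ∃ q ∈ perms4, ∀ f : Fin 4, q f = s (p f)) :
    anyRel R (fun f => τ (s f)) t = anyRel R τ t := by
  rw [Bool.eq_iff_iff]
  simp only [anyRel, List.any_eq_true, all4_iff]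
  constructor
  · rintro ⟨p, hp, hall⟩
    obtain ⟨q, hq, hqf⟩ := hc p hp
    exact ⟨q, hq, fun f => by rw [hqf f]; exact hall f⟩
  · rintro ⟨q, hq, hall⟩
    obtain ⟨p, hp, hpf⟩ := hc q hq
    refine ⟨p, hp, fun f => ?_⟩
    have e : s (p f) = q f := by rw [hpf f, hs]
    simp only [e]
    exact hall f

theorem sameM_swapL01 (t : STuple) (x y z w : Shape) : sameM ![y, x, z, w] t = sameM ![x, y, z, w] t := by
  unfold sameM; rw [vec_sw01 x y z w]; exact anyRel_compL _ _ t sw01 sw01_invol perms4_closedL01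
theorem sameM_swapL12 (t : STuple) (x y z w : Shape) : sameM ![x, z, y, w] t = sameM ![x, y, z, w] t := by
  unfold sameM; rw [vec_sw12 x y z w]; exact anyRel_compL _ _ t sw12 sw12_invol perms4_closedL12
theorem sameM_swapL23 (t : STuple) (x y z w : Shape) : sameM ![x, y, w, z] t = sameM ![x, y, z, w] t := by
  unfold sameM; rw [vec_sw23 x y z w]; exact anyRel_compL _ _ t sw23 sw23_invol perms4_closedL23

/-- hence every slot permutation `t` of an admissible sorted representative `τ` is among `ordsOf τ` (§25 `mem_ordsOf_of_sameM`), and a check that visits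
`(admTypesSorted h bs sd).flatMap ordsOf` visits the ordered type of every admissible supported cell — the ordered analogue of `kPt_all`'s last step. -/
example (τ t : STuple) (h : sameM τ t = true) : t ∈ ordsOf τ := mem_ordsOf_of_sameM h

/-! ## §34 (Δ6b) the ORDERED pointwise pass, ordered presence ∕ ban literals, and the ordered-leaf pointwise check
An ORDERED region leaf («OT-L1»: instrument (i) of the cell, director R19.545 ∕ R19.549 ∕ R19.563) prices ORDERED columns `x_{sd,t}` (t an ordered
admissible type): the leaf functional gains ordered e-free rows `Σ_r λ_r·(m_φ − m_ψ)(t)` (`erVal`, §25 — NOT slot-symmetric) and ordered presence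
literals `x_{sd,o} ≥ 1` (multiplier `Z ≥ 0`); the B&B branches on `x_{sd,o} ≥ 1 ∨ x_{sd,o} = 0` (`obdisj`, §36). The pointwise check therefore visits
EVERY ORDERING of every sorted admissible type; `oPt_all` carries it to every admissible ordered type (via §33's first-argument swaps).
Nothing here is a certificate; nothing toward `FloorFree 6 199 8`. -/

theorem sameM_self (t : STuple) : sameM t t = true := by
  simp only [sameM, anyRel, List.any_eq_true, all4_iff, decide_eq_true_eq]
  exact ⟨![0, 1, 2, 3], List.mem_cons_self .., fun f => by fin_cases f <;> rfl⟩

theorem sameM_of_mem_ordsOf {τ t : STuple} (h : t ∈ ordsOf τ) : sameM τ t = true := by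
  obtain ⟨p, hp, rfl⟩ := List.mem_map.mp h
  simp only [sameM, anyRel, List.any_eq_true, all4_iff, decide_eq_true_eq]
  exact ⟨p, hp, fun f => rfl⟩

/-- **the ordered pass**: a property checked on every ordering of every sorted admissible type holds at every admissible ordered type -/
theorem oPt_all {h : ℕ} {bs : List Bound} {sd : Side} (Q : STuple → Prop)
    (hchk : ∀ τ ∈ admTypesSorted h bs sd, ∀ t ∈ ordsOf τ, Q t) (t : STuple) (ha : admType h bs sd t = true) : Q t := by
  have key : ∀ x y z w, admType h bs sd ![x, y, z, w] = true → ∀ t' ∈ ordsOf ![x, y, z, w], Q t' := by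
    refine forall_of_sorted4 (rankOf (adm0 h sd)) (fun x y z w => admType h bs sd ![x, y, z, w] = true → ∀ t' ∈ ordsOf ![x, y, z, w], Q t')
      ?_ ?_ ?_ ?_
    · intro x y z w hP ha' t' ht'
      have hs := sameM_of_mem_ordsOf ht'
      rw [sameM_swapL01] at hs
      exact hP (admType_swap01 h bs sd x y z w ha') t' (mem_ordsOf_of_sameM hs)
    · intro x y z w hP ha' t' ht'
      have hs := sameM_of_mem_ordsOf ht'
      rw [sameM_swapL12] at hs
      exact hP (admType_swap12 h bs sd x y z w ha') t' (mem_ordsOf_of_sameM hs)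
    · intro x y z w hP ha' t' ht'
      have hs := sameM_of_mem_ordsOf ht'
      rw [sameM_swapL23] at hs
      exact hP (admType_swap23 h bs sd x y z w ha') t' (mem_ordsOf_of_sameM hs)
    · intro x y z w h1 h2 h3 ha' t' ht'
      have hx : (adm0 h sd).elem x = true := by simpa using admType_static ha' 0
      have hy : (adm0 h sd).elem y = true := by simpa using admType_static ha' 1
      have hz : (adm0 h sd).elem z = true := by simpa using admType_static ha' 2
      have hw : (adm0 h sd).elem w = true := by simpa using admType_static ha' 3
      exact hchk _ (List.mem_filter.mpr ⟨mem_stuples _ x y z w (List.mem_of_elem_eq_true hx) (List.mem_of_elem_eq_true hy)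
        (List.mem_of_elem_eq_true hz) (List.mem_of_elem_eq_true hw) h1 h2 h3, ha'⟩) t' ht'
  have ht : (![t 0, t 1, t 2, t 3] : STuple) = t := by
    funext f; fin_cases f <;> rfl
  have hk := key (t 0) (t 1) (t 2) (t 3)
  rw [ht] at hk
  exact hk ha t (mem_ordsOf_of_sameM (sameM_self t))

/-- ordered presence literal with multiplier: «a supported cell of side `side` has ordered type EXACTLY `o`», LP row `x_{side,o} ≥ 1`, `Z ≥ 0` -/
structure OPres where
  side : Side
  o : STuple
  Z : ℤ

def ohit (q : OPres) (sd : Side) (t : STuple) : Bool := decide (q.side = sd) && eqT q.o t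

/-- the ordered presence pay of a column: `Σ_{q : q hits (sd,t)} Z_q` -/
def oPay (ops : List OPres) (sd : Side) (t : STuple) : ℤ := (ops.map fun q => if ohit q sd t then q.Z else 0).sum

theorem eqT_self (a : STuple) : eqT a a = true := by simp [eqT]

theorem oPay_nonneg (ops : List OPres) (hZ : ∀ q ∈ ops, 0 ≤ q.Z) (sd : Side) (t : STuple) : 0 ≤ oPay ops sd t := by
  unfold oPay
  refine List.sum_nonneg ?_
  intro x hx
  obtain ⟨q, hq, rfl⟩ := List.mem_map.mp hx
  by_cases hm : ohit q sd t = true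
  · simp [hm, hZ q hq]
  · simp [hm]

/-- (credit 8) ordered presence literals: `Σ_q Z_q ≤ Σ_c m(c)·oPay(c)` -/
theorem op_credit (D : Design) (ops : List OPres) (hZ : ∀ q ∈ ops, 0 ≤ q.Z) (hop : ∀ q ∈ ops, OPresent D q.side q.o) :
    (ops.map fun q => q.Z).sum ≤ linZ D.N (fun c => oPay ops Side.N (typeOf c)) + linZ D.P (fun c => oPay ops Side.P (typeOf c)) := by
  induction ops with
  | nil => simp [oPay, linZ]
  | cons q rest ih =>
      have hZ' : ∀ q' ∈ rest, 0 ≤ q'.Z := fun q' hq' => hZ q' (List.mem_cons.mpr (Or.inr hq'))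
      have hop' : ∀ q' ∈ rest, OPresent D q'.side q'.o := fun q' hq' => hop q' (List.mem_cons.mpr (Or.inr hq'))
      have ih' := ih hZ' hop'
      have hsplit : ∀ sd : Side, (fun c => oPay (q :: rest) sd (typeOf c)) =
          fun c => (if ohit q sd (typeOf c) then q.Z else 0) + oPay rest sd (typeOf c) := by
        intro sd; funext c; simp [oPay]
      rw [hsplit Side.N, hsplit Side.P, linZ_add, linZ_add]
      obtain ⟨c₀, hc₀, ht₀⟩ := hop q (List.mem_cons.mpr (Or.inl rfl))
      have hq0 : 0 ≤ q.Z := hZ q (List.mem_cons.mpr (Or.inl rfl))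
      have hhit : ohit q q.side (typeOf c₀) = true := by simp [ohit, ht₀, eqT_self]
      have key := one_le_linZ_sides D (fun sd c => if ohit q sd (typeOf c) then (1 : ℤ) else 0)
        (fun sd c => by by_cases hm : ohit q sd (typeOf c) = true <;> simp [hm]) hc₀ (by simp [hhit])
      have eN : (fun c => if ohit q Side.N (typeOf c) then q.Z else 0) =
          fun c => q.Z * (if ohit q Side.N (typeOf c) then (1 : ℤ) else 0) := by
        funext c; split <;> simp
      have eP : (fun c => if ohit q Side.P (typeOf c) then q.Z else 0) =
          fun c => q.Z * (if ohit q Side.P (typeOf c) then (1 : ℤ) else 0) := by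
        funext c; split <;> simp
      rw [eN, eP, linZ_smul, linZ_smul]
      simp only [List.map_cons, List.sum_cons]
      nlinarith [key, hq0, ih']

/-- ordered ban literals «no supported cell of side `sd` has ordered type exactly `o`» (the `x_{sd,o} = 0` branch): the column is skipped -/
def obanHit (obans : List (Side × STuple)) (sd : Side) (t : STuple) : Bool := obans.any fun b => decide (b.1 = sd) && eqT b.2 t

theorem obanHit_false_of {D : Design} {obans : List (Side × STuple)} {sd : Side} {c : Cell} (hob : ∀ b ∈ obans, ¬ OPresent D b.1 b.2)
    (hc : c ∈ suppSide D sd) : obanHit obans sd (typeOf c) = false := by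
  rcases Bool.eq_false_or_eq_true (obanHit obans sd (typeOf c)) with h | h
  · exfalso
    simp only [obanHit, List.any_eq_true, Bool.and_eq_true, decide_eq_true_eq] at h
    obtain ⟨b, hb, hsd, he⟩ := h
    exact hob b hb ⟨c, by rw [hsd]; exact hc, (eqT_eq he).symm⟩
  · exact h

/-- **the ordered pointwise check**: Δ3's `checkPtK` inequality with ordered e-free rows in the functional, an extra (arbitrary) type pay `X` and an extra
(arbitrary) skip predicate `oskip`, over EVERY ORDERING of every sorted admissible type -/
def checkPtO (h : ℕ) (bs : List Bound) (E : List (Var × VarRec)) (γ : Coefs) (L ρ : ℤ) (bans : List (Side × STuple)) (pres : List Pres)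
    (kbans : List KLit) (kpres : List KPres) (ephi : List EPhi) (orows : List ERow) (X : Side → STuple → ℤ) (oskip : Side → STuple → Bool)
    (sd : Side) : Bool :=
  (admTypesSorted h bs sd).all fun τ => (ordsOf τ).all fun t =>
    ((banHit bans sd t || decide (0 < emptyCnt sd kbans t)) || oskip sd t) ||
      decide (sd.sgn * (Gtype γ t + erVal orows t) + coverPay E sd t + presPay pres sd t + QK sd ephi kpres kbans t + X sd t ≤ sd.bnd L ρ)

/-- the ordered pointwise check is sound on every supported cell of an admissible, non-banned, non-skipped type whose letters respect the key bans -/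
theorem checkPtO_sound {h : ℕ} {bs : List Bound} {E : List (Var × VarRec)} {γ : Coefs} {L ρ : ℤ} {bans : List (Side × STuple)} {pres : List Pres}
    {kbans : List KLit} {kpres : List KPres} {ephi : List EPhi} {orows : List ERow} {X : Side → STuple → ℤ} {oskip : Side → STuple → Bool} {sd : Side}
    (hchk : checkPtO h bs E γ L ρ bans pres kbans kpres ephi orows X oskip sd = true) (c : Cell)
    (hadm : admType h bs sd (typeOf c) = true) (hnb : banHit bans sd (typeOf c) = false) (hkb : ∀ f : Fin 4, kbanAt kbans sd (typeOf c) (c f) = false)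
    (hns : oskip sd (typeOf c) = false) :
    sd.sgn * (Gcell γ c + GE ephi c + erVal orows (typeOf c))
      + (coverPay E sd (typeOf c) + presPay pres sd (typeOf c) + keyPay kpres sd c + X sd (typeOf c)) ≤ sd.bnd L ρ := by
  simp only [checkPtO, List.all_eq_true, Bool.or_eq_true, decide_eq_true_eq] at hchk
  have hmem : ∀ f : Fin 4, c f ∈ cand kbans sd (typeOf c) (typeOf c f) := fun f =>
    List.mem_filter.mpr ⟨mem_letters_shapeOf (c f), by simp [hkb f]⟩
  have hempty : emptyCnt sd kbans (typeOf c) = 0 := by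
    simp only [emptyCnt, isEmpty_false_of_mem (hmem 0), isEmpty_false_of_mem (hmem 1), isEmpty_false_of_mem (hmem 2),
      isEmpty_false_of_mem (hmem 3), indB]
    simp
  have hQ := oPt_all _ hchk (typeOf c) hadm
  rcases hQ with ((hban | hemp) | hsk) | hineq
  · rw [hnb] at hban
    exact absurd hban Bool.false_ne_true
  · rw [hempty] at hemp
    exact absurd hemp (lt_irrefl 0)
  · rw [hns] at hsk
    exact absurd hsk Bool.false_ne_true
  · have hslots : sd.sgn * GE ephi c + keyPay kpres sd c =
        slotVal sd ephi kpres (typeOf c) (pas0 (typeOf c)) (c 0) + slotVal sd ephi kpres (typeOf c) (pas1 (typeOf c)) (c 1)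
          + slotVal sd ephi kpres (typeOf c) (pas2 (typeOf c)) (c 2) + slotVal sd ephi kpres (typeOf c) (pas3 (typeOf c)) (c 3) := by
      rw [keyPay_eq_slots]
      simp only [GE, slotVal]
      ring
    have hle : ∀ (σ : Shape) (π : STri) (ℓ : Letter), ℓ ∈ cand kbans sd (typeOf c) σ →
        slotVal sd ephi kpres (typeOf c) π ℓ ≤ slotMax sd ephi kpres kbans (typeOf c) σ π :=
      fun σ π ℓ hℓ => le_lmax1_of_mem (List.mem_map.mpr ⟨ℓ, hℓ, rfl⟩)
    have h0 := hle _ (pas0 (typeOf c)) _ (hmem 0)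
    have h1 := hle _ (pas1 (typeOf c)) _ (hmem 1)
    have h2 := hle _ (pas2 (typeOf c)) _ (hmem 2)
    have h3 := hle _ (pas3 (typeOf c)) _ (hmem 3)
    rw [Gcell_eq_Gtype]
    unfold QK at hineq
    have hdist : sd.sgn * (Gtype γ (typeOf c) + GE ephi c + erVal orows (typeOf c))
        = sd.sgn * Gtype γ (typeOf c) + sd.sgn * GE ephi c + sd.sgn * erVal orows (typeOf c) := by ring
    have hdist2 : sd.sgn * (Gtype γ (typeOf c) + erVal orows (typeOf c)) = sd.sgn * Gtype γ (typeOf c) + sd.sgn * erVal orows (typeOf c) := by ring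
    linarith [hslots, h0, h1, h2, h3, hineq]

/-! ### §34b (Δ6c) ORDERED aggregated (A4)-cover rows — `oagg_credit` (director R19.572: load-bearing for the one-root-LP half-region closure and for OT-BB leaves)
The row of an ordered column `(side, o)`: `x_{side,o} ≤ B · Σ_{t ∈ OCov(side,o)} x_{other side,t}`, `OCov` = the ordered types of the other side that
are SLOTWISE live-compatible with `o` in the SAME slots (no permutation: `Design.A4` is slotwise via `Live`) — `belowB (o f) (t f)` for a P-column,
`belowB (t f) (o f)` for an N-column; priced `V ≥ 0`, credit `0`, big-M = `B` is sound because `x_{side,o} ≤ copies ≤ B`. -/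

structure OAgg where
  side : Side
  o : STuple
  V : ℤ

/-- the ordered cover hit: column `(sd, t)` is on the OTHER side and slotwise live-compatible with `o` -/
def ocovHit (r : OAgg) (sd : Side) (t : STuple) : Bool :=
  match r.side, sd with
  | Side.P, Side.N => all4 fun f => belowB (r.o f) (t f)
  | Side.N, Side.P => all4 fun f => belowB (t f) (r.o f)
  | _, _ => false

def omassHit (r : OAgg) (sd : Side) (t : STuple) : Bool := decide (r.side = sd) && eqT r.o t

/-- pointwise pay of the ordered aggregated cover rows: `−V` on the row's own ordered column, `+V·B` on the covering columns of the other side -/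
def oaggPay (B : ℕ) (rs : List OAgg) (sd : Side) (t : STuple) : ℤ :=
  (rs.map fun r => -r.V * indB (omassHit r sd t) + r.V * (B : ℤ) * indB (ocovHit r sd t)).sum

/-- the ORDERED mass `x_{sd,o}` -/
def omass (D : Design) (sd : Side) (o : STuple) : ℤ := linZ (mlist D sd) fun c => indB (eqT o (typeOf c))

theorem omass_le_copies (D : Design) (sd : Side) (o : STuple) : omass D sd o ≤ D.copies := by
  have h1 := linZ_le_mul_sum (mlist D sd) (fun c => indB (eqT o (typeOf c))) 1 (fun cm _ _ => indB_le_one _)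
  rw [one_mul] at h1
  have h2 : (((mlist D sd).map Prod.snd).sum : ℕ) ≤ D.copies := by
    unfold Design.copies
    cases sd with
    | N => exact Nat.le_add_right _ _
    | P => exact Nat.le_add_left _ _
  have h3 : ((((mlist D sd).map Prod.snd).sum : ℕ) : ℤ) ≤ (D.copies : ℤ) := by exact_mod_cast h2
  unfold omass
  linarith

theorem omass_nonpos_of_not_opresent {D : Design} {sd : Side} {o : STuple} (hno : ¬ OPresent D sd o) : omass D sd o ≤ 0 := by
  have h1 := linZ_le_mul_sum (mlist D sd) (fun c => indB (eqT o (typeOf c))) 0 (fun cm hcm hpos => by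
    have hc : cm.1 ∈ suppSide D sd := (mem_suppSide_iff D sd cm.1).mpr ⟨cm.2, hcm, hpos⟩
    show indB (eqT o (typeOf cm.1)) ≤ 0
    rcases Bool.eq_false_or_eq_true (eqT o (typeOf cm.1)) with h | h
    · exact absurd ⟨cm.1, hc, (eqT_eq h).symm⟩ hno
    · rw [h]; simp [indB])
  rw [zero_mul] at h1
  exact h1

theorem ocovHit_P {r : OAgg} (hs : r.side = Side.P) {c y : Cell} (h : r.o = typeOf c) (hl : Live c y) : ocovHit r Side.N (typeOf y) = true := by
  obtain ⟨rs, o, V⟩ := r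
  simp only at hs h
  subst hs
  subst h
  simp only [ocovHit, all4_iff]
  exact fun f => belowB_of_ample _ _ (hl f)

theorem ocovHit_N {r : OAgg} (hs : r.side = Side.N) {x y : Cell} (h : r.o = typeOf y) (hl : Live x y) : ocovHit r Side.P (typeOf x) = true := by
  obtain ⟨rs, o, V⟩ := r
  simp only at hs h
  subst hs
  subst h
  simp only [ocovHit, all4_iff]
  exact fun f => belowB_of_ample _ _ (hl f)

theorem linZ_oaggPay (L' : List (Cell × ℕ)) (B : ℕ) (rs : List OAgg) (sd : Side) :
    linZ L' (fun c => oaggPay B rs sd (typeOf c)) =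
      (rs.map fun r => -r.V * linZ L' (fun c => indB (omassHit r sd (typeOf c))) + r.V * (B : ℤ) * linZ L' (fun c => indB (ocovHit r sd (typeOf c)))).sum := by
  unfold oaggPay
  rw [linZ_sum_map L' rs (fun r c => -r.V * indB (omassHit r sd (typeOf c)) + r.V * (B : ℤ) * indB (ocovHit r sd (typeOf c)))]
  congr 1
  refine List.map_congr_left fun r _ => ?_
  rw [linZ_add, linZ_smul, linZ_smul]

theorem linZ_sides_omassHit (D : Design) (r : OAgg) :
    linZ D.N (fun c => indB (omassHit r Side.N (typeOf c))) + linZ D.P (fun c => indB (omassHit r Side.P (typeOf c))) = omass D r.side r.o := by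
  simp only [omassHit, indB_and]
  exact linZ_sides_gate D r.side _

/-- **(credit 9) `oagg_credit`**: the ordered aggregated (A4)-cover rows cost nothing: `0 ≤ Σ_c m(c)·oaggPay(c)` under (A4) and `copies ≤ B`. -/
theorem oagg_credit (D : Design) (h4 : D.A4) (B : ℕ) (hB : D.copies ≤ B) (rs : List OAgg) (hV : ∀ r ∈ rs, 0 ≤ r.V) :
    0 ≤ linZ D.N (fun c => oaggPay B rs Side.N (typeOf c)) + linZ D.P (fun c => oaggPay B rs Side.P (typeOf c)) := by
  have key : ∀ r ∈ rs, 0 ≤ (-r.V * linZ D.N (fun c => indB (omassHit r Side.N (typeOf c))) + r.V * (B : ℤ) * linZ D.N (fun c => indB (ocovHit r Side.N (typeOf c))))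
      + (-r.V * linZ D.P (fun c => indB (omassHit r Side.P (typeOf c))) + r.V * (B : ℤ) * linZ D.P (fun c => indB (ocovHit r Side.P (typeOf c)))) := by
    intro r hr
    have hmass := linZ_sides_omassHit D r
    have hcov0 : 0 ≤ linZ D.N (fun c => indB (ocovHit r Side.N (typeOf c))) + linZ D.P (fun c => indB (ocovHit r Side.P (typeOf c))) := by
      have a := linZ_nonneg D.N (fun c => indB (ocovHit r Side.N (typeOf c))) fun _ _ _ => indB_nonneg _
      have b := linZ_nonneg D.P (fun c => indB (ocovHit r Side.P (typeOf c))) fun _ _ _ => indB_nonneg _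
      linarith
    have hB' : (D.copies : ℤ) ≤ (B : ℤ) := by exact_mod_cast hB
    have hmc := omass_le_copies D r.side r.o
    have hkey : omass D r.side r.o ≤ (B : ℤ) * (linZ D.N (fun c => indB (ocovHit r Side.N (typeOf c)))
        + linZ D.P (fun c => indB (ocovHit r Side.P (typeOf c)))) := by
      rcases Classical.em (OPresent D r.side r.o) with ⟨c₀, hc₀, ht₀⟩ | hno
      · have hcov : 1 ≤ linZ D.N (fun c => indB (ocovHit r Side.N (typeOf c))) + linZ D.P (fun c => indB (ocovHit r Side.P (typeOf c))) := by
          cases hs : r.side with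
          | P =>
            rw [hs] at hc₀
            obtain ⟨y, hy, hl⟩ := h4.1 c₀ hc₀
            exact one_le_linZ_sides D (fun sd c => indB (ocovHit r sd (typeOf c))) (fun _ _ => indB_nonneg _) hy (by
              show 1 ≤ indB (ocovHit r Side.N (typeOf y))
              rw [ocovHit_P hs ht₀.symm hl]; simp [indB])
          | N =>
            rw [hs] at hc₀
            obtain ⟨x, hx, hl⟩ := h4.2 c₀ hc₀
            exact one_le_linZ_sides D (fun sd c => indB (ocovHit r sd (typeOf c))) (fun _ _ => indB_nonneg _) hx (by
              show 1 ≤ indB (ocovHit r Side.P (typeOf x))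
              rw [ocovHit_N hs ht₀.symm hl]; simp [indB])
        have hB0 : (0 : ℤ) ≤ (B : ℤ) := by positivity
        have := mul_le_mul_of_nonneg_left hcov hB0
        linarith
      · have := omass_nonpos_of_not_opresent hno
        have hB0 : (0 : ℤ) ≤ (B : ℤ) := by positivity
        nlinarith
    have h1 := mul_le_mul_of_nonneg_left (sub_nonneg.mpr hkey) (hV r hr)
    rw [← hmass] at h1
    nlinarith [h1]
  rw [linZ_oaggPay, linZ_oaggPay, ← List.sum_map_add]
  refine List.sum_nonneg ?_
  intro v hv
  obtain ⟨r, hr, rfl⟩ := List.mem_map.mp hv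
  exact key r hr

/-! ## §35 (Δ6b) the ORDERED REGION LEAF «v1 + L1.5 + ℤ + S + O» and its Farkas lemma -/

/-- an ordered leaf: Δ6a's leaf + ordered e-free rows (each of equal filtration degree on both sides) + ordered presence literals with multipliers +
the ordered ban literals it relies on (columns skipped) + ordered aggregated (A4)-cover rows (§34b) -/
structure LeafO where
  n : LeafN
  orows : List ERow
  ops : List OPres
  obans : List (Side × STuple)
  oaggs : List OAgg

structure CertO where
  h : ℕ
  B : ℕ
  rmin : ℤ
  vars : List Var
  leaves : List LeafO
  fams : List EFAFam

def CertO.toN (C : CertO) : CertN := ⟨C.h, C.B, C.rmin, C.vars, C.leaves.map fun lf => lf.n, C.fams⟩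

def LeafO.LitsHold (lf : LeafO) (D : Design) : Prop :=
  lf.n.LitsHold D ∧ (∀ q ∈ lf.ops, OPresent D q.side q.o) ∧ (∀ b ∈ lf.obans, ¬ OPresent D b.1 b.2)

/-- Δ6a's core conjuncts + `degOK` of every ordered row + `Z ≥ 0` (ordered presence) + `V ≥ 0` (ordered agg cover) + the closing inequality WITH `+ Σ_q Z_q` -/
def checkCoreO (C : CertO) (lf : LeafO) : Bool :=
  let b := lf.n.m.core.base
  let E := ents C.vars b
  let bs := allBounds C.vars b
  decide (b.recs.length = C.vars.length) &&
  checkDerivedAll C.h (primaryBounds E) b.derived &&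
  decide (0 ≤ b.L) && decide (0 ≤ b.ρ) &&
  (E.all fun e => decide (0 ≤ e.2.Y) && thrOK C.h bs b.laws e) &&
  (lf.n.m.core.pres.all fun r => decide (0 ≤ r.Z) && decide (0 ≤ r.W)) &&
  (lf.n.m.core.kpres.all fun r => decide (0 ≤ r.Z) && decide (0 ≤ r.W)) &&
  (lf.n.m.mges.all fun r => decide (0 ≤ r.Z)) &&
  (lf.n.m.mles.all fun r => decide (0 ≤ r.U)) &&
  (lf.n.m.aggs.all fun r => decide (0 ≤ r.V)) &&
  (lf.n.ngs.all fun g => decide (0 ≤ g.Z)) &&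
  (rowsE lf.n.m.core.ephi).all rowOK &&
  (lf.orows.all ERow.degOK) &&
  (lf.ops.all fun q => decide (0 ≤ q.Z)) &&
  (lf.oaggs.all fun r => decide (0 ≤ r.V)) &&
  decide (b.L * (C.B : ℤ) < (E.map fun e => e.2.Y * (e.2.thr : ℤ)).sum + b.ρ * C.rmin
    + (lf.n.m.core.pres.map fun r => r.Z + r.W).sum + (lf.n.m.core.kpres.map fun r => r.Z + r.W).sum
    + (lf.n.m.mges.map fun r => r.Z * (r.k : ℤ)).sum - (lf.n.m.mles.map fun r => r.U * (r.k : ℤ)).sum + (lf.n.ngs.map fun g => g.Z).sum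
    + (lf.ops.map fun q => q.Z).sum)

/-- the extra type pay of an ordered leaf: no-good pay + ordered presence pay + ordered aggregated-cover pay (big-M = `B`) -/
def LeafO.X (B : ℕ) (lf : LeafO) (sd : Side) (t : STuple) : ℤ := ngPay lf.n.ngs sd t + oPay lf.ops sd t + oaggPay B lf.oaggs sd t

/-- **ordered leaf check** («v1 + L1.5 + ℤ + S + O») -/
def checkLeafO (C : CertO) (lf : LeafO) : Bool :=
  match lf.n.m.core.base.func with
  | Func.cls γ =>
      checkCoreO C lf &&
      checkPtO C.h (allBounds C.vars lf.n.m.core.base) (ents C.vars lf.n.m.core.base) γ lf.n.m.core.base.L lf.n.m.core.base.ρ lf.n.m.core.bans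
        (lf.n.m.presEff C.B) lf.n.m.core.kbans lf.n.m.core.kpres lf.n.m.core.ephi lf.orows (lf.X C.B) (obanHit lf.obans) Side.N &&
      checkPtO C.h (allBounds C.vars lf.n.m.core.base) (ents C.vars lf.n.m.core.base) γ lf.n.m.core.base.L lf.n.m.core.base.ρ lf.n.m.core.bans
        (lf.n.m.presEff C.B) lf.n.m.core.kbans lf.n.m.core.kpres lf.n.m.core.ephi lf.orows (lf.X C.B) (obanHit lf.obans) Side.P
  | Func.cell _ => false

theorem checkLeafO_cls {C : CertO} {lf : LeafO} (h : checkLeafO C lf = true) :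
    ∃ γ : Coefs, lf.n.m.core.base.func = Func.cls γ ∧ checkCoreO C lf = true ∧
      checkPtO C.h (allBounds C.vars lf.n.m.core.base) (ents C.vars lf.n.m.core.base) γ lf.n.m.core.base.L lf.n.m.core.base.ρ lf.n.m.core.bans
        (lf.n.m.presEff C.B) lf.n.m.core.kbans lf.n.m.core.kpres lf.n.m.core.ephi lf.orows (lf.X C.B) (obanHit lf.obans) Side.N = true ∧
      checkPtO C.h (allBounds C.vars lf.n.m.core.base) (ents C.vars lf.n.m.core.base) γ lf.n.m.core.base.L lf.n.m.core.base.ρ lf.n.m.core.bans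
        (lf.n.m.presEff C.B) lf.n.m.core.kbans lf.n.m.core.kpres lf.n.m.core.ephi lf.orows (lf.X C.B) (obanHit lf.obans) Side.P = true := by
  unfold checkLeafO at h
  split at h
  · rename_i γ hγ
    simp only [Bool.and_eq_true] at h
    exact ⟨γ, hγ, h.1.1, h.1.2, h.2⟩
  · exact absurd h Bool.false_ne_true

theorem hder_of_checkLeafO {C : CertO} {lf : LeafO} (h : checkLeafO C lf = true) :
    checkDerivedAll C.h (primaryBounds (ents C.vars lf.n.m.core.base)) lf.n.m.core.base.derived = true := by
  obtain ⟨γ, _, hcore, _, _⟩ := checkLeafO_cls h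
  simp only [checkCoreO, Bool.and_eq_true, decide_eq_true_eq] at hcore
  obtain ⟨⟨⟨⟨⟨⟨⟨⟨⟨⟨⟨⟨⟨⟨⟨_, hder⟩, _⟩, _⟩, _⟩, _⟩, _⟩, _⟩, _⟩, _⟩, _⟩, _⟩, _⟩, _⟩, _⟩, _⟩ := hcore
  exact hder

/-- **ORDERED LEAF FARKAS («v1 + L1.5 + ℤ + S + O») — PROVED**: `leafN_sound`'s functional + the ordered e-free rows (balanced by `erVal_balance`),
its pays + the ordered presence pay (credit (8) `op_credit`) + the ordered aggregated-cover pay (credit (9) `oagg_credit`, `≥ 0`), columns of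
ordered-banned types skipped. -/
theorem leafO_sound (C : CertO) (lf : LeafO) (hlf : checkLeafO C lf = true) (D : Design) (h1 : D.A1) (h4 : D.A4)
    (hB : D.copies ≤ C.B) (hr : C.rmin ≤ D.rank) (hN : D.suppN ≠ []) (hP : D.suppP ≠ [])
    (hreg : InRegion C.vars lf.n.m.core.base D)
    (hadm : ∀ sd : Side, ∀ c' ∈ suppSide D sd, admType C.h (allBounds C.vars lf.n.m.core.base) sd (typeOf c') = true)
    (hlits : lf.LitsHold D) (hparity : ParityOK C.toN.toM.toB lf.n.m.core.base D) : False := by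
  obtain ⟨⟨⟨⟨hbans, hpres, hkbans, hkpres⟩, hmges, hmles⟩, hngs⟩, hops, hobans⟩ := hlits
  obtain ⟨γ, _hfunc, hcore, hNall, hPall⟩ := checkLeafO_cls hlf
  simp only [checkCoreO, Bool.and_eq_true, decide_eq_true_eq, List.all_eq_true] at hcore
  obtain ⟨⟨⟨⟨⟨⟨⟨⟨⟨⟨⟨⟨⟨⟨⟨_hlen, _hder⟩, hL⟩, hρ⟩, hYthr⟩, hZW⟩, hKZW⟩, hMZ⟩, hMU⟩, hAV⟩, hNG⟩, hrows⟩, hdeg⟩, hOZ⟩, hOV⟩, hclose⟩ := hcore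
  have hrows' : (rowsE lf.n.m.core.ephi).all rowOK = true := List.all_eq_true.mpr hrows
  refine farkas_core D C.B C.rmin hB hr (fun c => Gcell γ c + GE lf.n.m.core.ephi c + erVal lf.orows (typeOf c)) ?_
    (fun sd c => coverPay (ents C.vars lf.n.m.core.base) sd (typeOf c) + presPay (lf.n.m.presEff C.B) sd (typeOf c) + keyPay lf.n.m.core.kpres sd c
      + lf.X C.B sd (typeOf c))
    (((ents C.vars lf.n.m.core.base).map fun e => e.2.Y * (e.2.thr : ℤ)).sum + (lf.n.m.core.pres.map fun r => r.Z + r.W).sum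
      + (lf.n.m.core.kpres.map fun r => r.Z + r.W).sum + (lf.n.m.mges.map fun r => r.Z * (r.k : ℤ)).sum
      - (lf.n.m.mles.map fun r => r.U * (r.k : ℤ)).sum + (lf.n.ngs.map fun g => g.Z).sum + (lf.ops.map fun q => q.Z).sum)
    lf.n.m.core.base.L lf.n.m.core.base.ρ hL hρ ?_ ?_ ?_
  · have hG := G_vanishes D h1 γ
    have hE := GE_balance D h1 lf.n.m.core.ephi hrows'
    have hO := erVal_balance D h1 lf.orows hdeg
    simp only [linZ_add]
    have e1 : linZ D.N (fun c => Gcell γ c) = linZ D.N (Gcell γ) := rfl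
    have e2 : linZ D.P (fun c => Gcell γ c) = linZ D.P (Gcell γ) := rfl
    have e3 : linZ D.N (fun c => GE lf.n.m.core.ephi c) = linZ D.N (GE lf.n.m.core.ephi) := rfl
    have e4 : linZ D.P (fun c => GE lf.n.m.core.ephi c) = linZ D.P (GE lf.n.m.core.ephi) := rfl
    rw [e1, e2, e3, e4]
    linarith
  · have h1c := coverPay_credit C.toN.toM.toB lf.n.m.core.base D hYthr hreg hN hP hparity
    have h2c := presPay_credit D h4 lf.n.m.core.pres hZW hpres
    have h3c := keyPay_credit D h4 lf.n.m.core.kpres hKZW hkpres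
    have h4c := mge_credit D lf.n.m.mges hMZ hmges
    have h5c := mle_credit D lf.n.m.mles hMU hmles
    have h6c := agg_credit D h4 C.B hB lf.n.m.aggs hAV
    have h7c := ng_credit D lf.n.ngs hNG hngs
    have h8c := op_credit D lf.ops hOZ hops
    have h9c := oagg_credit D h4 C.B hB lf.oaggs hOV
    change ((ents C.vars lf.n.m.core.base).map fun e => e.2.Y * (e.2.thr : ℤ)).sum
      ≤ linZ D.N (fun c => coverPay (ents C.vars lf.n.m.core.base) Side.N (typeOf c))
        + linZ D.P (fun c => coverPay (ents C.vars lf.n.m.core.base) Side.P (typeOf c)) at h1c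
    simp only [LeafO.X, LeafM.presEff, presPay_append, linZ_add]
    linarith
  · intro sd c hc
    have hnb := banHit_false_of_banned hbans hc
    have hkb : ∀ f : Fin 4, kbanAt lf.n.m.core.kbans sd (typeOf c) (c f) = false := fun f => kbanAt_false_of_kbanned hkbans hc f
    have hns : obanHit lf.obans sd (typeOf c) = false := obanHit_false_of hobans hc
    cases sd with
    | N => exact checkPtO_sound hNall c (hadm Side.N c hc) hnb hkb hns
    | P => exact checkPtO_sound hPall c (hadm Side.P c hc) hnb hkb hns
  · linarith

/-! ## §36 (Δ6b) The tree over ORDERED leaves with ordered-column branching `obdisj`, and its soundness -/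

inductive CTreeO where
  | leaf (i : ℕ)
  | efa (j : ℕ)
  | node (q : ℕ) (kids : List CTreeO)
  | disj (sd : Side) (τ : STuple) (absent present : CTreeO)
  | kdisj (sd : Side) (τ : STuple) (ℓ : Letter) (absent present : CTreeO)
  | mdisj (sd : Side) (τ : STuple) (k : ℕ) (atMost atLeast : CTreeO)
  | sdisj (S : List (Side × STuple)) (inside outside : CTreeO)
  | obdisj (sd : Side) (o : STuple) (absent present : CTreeO)

structure OPath where
  n : NPath
  ops : List (Side × STuple)
  obans : List (Side × STuple)

def OPath.Holds (p : OPath) (D : Design) : Prop :=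
  p.n.Holds D ∧ (∀ q ∈ p.ops, OPresent D q.1 q.2) ∧ (∀ b ∈ p.obans, ¬ OPresent D b.1 b.2)

def OPath.nil : OPath := ⟨NPath.nil, [], []⟩

theorem OPath.nil_holds (D : Design) : OPath.nil.Holds D := ⟨NPath.nil_holds D, by simp [OPath.nil], by simp [OPath.nil]⟩

/-- ordered LP leaf fits: Δ6a's fitting on the N-part of the path + each ordered presence ∕ ban literal of the leaf is (syntactically) on the path -/
def leafFitsO (lf : LeafO) (asg : List (Option ℕ)) (p : OPath) : Bool :=
  leafFitsN lf.n asg p.n && (lf.ops.all fun q => memLit p.ops (q.side, q.o)) && (lf.obans.all fun b => memLit p.obans b)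

theorem leafFitsO_sound {lf : LeafO} {asg : List (Option ℕ)} {p : OPath} (h : leafFitsO lf asg p = true) (D : Design) (hp : p.Holds D) :
    lf.n.m.core.base.recs.map VarRec.cap = asg ∧ lf.LitsHold D := by
  simp only [leafFitsO, Bool.and_eq_true, List.all_eq_true] at h
  obtain ⟨⟨hN, hops⟩, hob⟩ := h
  obtain ⟨hpN, hpo, hpb⟩ := hp
  obtain ⟨hcaps, hlitsN⟩ := leafFitsN_sound hN D hpN
  refine ⟨hcaps, hlitsN, fun q hq => ?_, fun b hb => ?_⟩
  · obtain ⟨b', hb', h1, h2⟩ := memLit_sound (hops q hq)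
    have := hpo b' hb'
    rw [h1, h2] at this
    exact this
  · obtain ⟨b', hb', h1, h2⟩ := memLit_sound (hob b hb)
    have := hpb b' hb'
    rw [h1, h2] at this
    exact this

/-- cover check with fuel (Δ6a's + `obdisj`, which pushes `(sd, o)` onto `obans` ∕ `ops`) -/
def coverTO (C : CertO) : CTreeO → ℕ → List (Option ℕ) → OPath → Bool
  | .leaf i, _, asg, p =>
      match C.leaves[i]? with
      | some lf => leafFitsO lf asg p
      | none => false
  | .efa j, _, _, p =>
      match C.fams[j]? with
      | some F => efaFits F C.B p.n
      | none => false
  | .node _ _, 0, _, _ => false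
  | .node q kids, fuel + 1, asg, p =>
      decide (q < asg.length) && decide (kids.length = 5) &&
        ((List.range 5).all fun k =>
          match kids[k]? with
          | some t => coverTO C t fuel (setAt asg q k) p
          | none => false)
  | .disj _ _ _ _, 0, _, _ => false
  | .disj sd τ A B, fuel + 1, asg, p =>
      coverTO C A fuel asg {p with n := {p.n with m := {p.n.m with bans := (sd, τ) :: p.n.m.bans}}} &&
        coverTO C B fuel asg {p with n := {p.n with m := {p.n.m with pres := (sd, τ) :: p.n.m.pres}}}
  | .kdisj _ _ _ _ _, 0, _, _ => false
  | .kdisj sd τ ℓ A B, fuel + 1, asg, p =>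
      coverTO C A fuel asg {p with n := {p.n with m := {p.n.m with kbans := (sd, τ, ℓ) :: p.n.m.kbans}}} &&
        coverTO C B fuel asg {p with n := {p.n with m := {p.n.m with kpres := (sd, τ, ℓ) :: p.n.m.kpres}}}
  | .mdisj _ _ _ _ _, 0, _, _ => false
  | .mdisj sd τ k A B, fuel + 1, asg, p =>
      coverTO C A fuel asg {p with n := {p.n with m := {p.n.m with mles := (sd, τ, k) :: p.n.m.mles}}} &&
        coverTO C B fuel asg {p with n := {p.n with m := {p.n.m with mges := (sd, τ, k + 1) :: p.n.m.mges}}}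
  | .sdisj _ _ _, 0, _, _ => false
  | .sdisj S A B, fuel + 1, asg, p =>
      coverTO C A fuel asg {p with n := {p.n with only := S :: p.n.only}} && coverTO C B fuel asg {p with n := {p.n with ngs := S :: p.n.ngs}}
  | .obdisj _ _ _ _, 0, _, _ => false
  | .obdisj sd o A B, fuel + 1, asg, p =>
      coverTO C A fuel asg {p with obans := (sd, o) :: p.obans} && coverTO C B fuel asg {p with ops := (sd, o) :: p.ops}

def rootCoverTO (C : CertO) (t : CTreeO) (fuel : ℕ) : Bool :=
  match t with
  | .node 0 kids =>
      decide (0 < C.vars.length) && decide (kids.length = 5) &&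
        ((List.range 5).all fun k => decide (k = 0) ||
          match kids[k]? with
          | some s => coverTO C s fuel (setAt (List.replicate C.vars.length none) 0 k) OPath.nil
          | none => false)
  | _ => coverTO C t fuel (List.replicate C.vars.length none) OPath.nil

/-- **whole-node checker** («v1 + L1.5 + ℤ + S + O») -/
def validTO (C : CertO) (t : CTreeO) (fuel : ℕ) : Bool :=
  decide (C.vars[0]? = some ⟨Side.P, floorStat C.h⟩) &&
  (C.leaves.all fun lf => checkLeafO C lf) &&
  (C.fams.all validEFAFam) &&
  rootCoverTO C t fuel

/-- **the per-REGION checker** («v1 + L1.5 + ℤ + S + O») -/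
def validRO (C : CertO) (t : CTreeO) (fuel : ℕ) (caps : List (Option ℕ)) : Bool :=
  decide (caps.length = C.vars.length) &&
  (C.leaves.all fun lf => checkLeafO C lf) &&
  (C.fams.all validEFAFam) &&
  coverTO C t fuel caps OPath.nil

/-- cover yields: an ordered LP leaf of the region whose literals hold, OR an EFA family with `SuppIn` + anchor `Present` -/
def LeafOrEFAO (C : CertO) (D : Design) (ks : List ℕ) : Prop :=
  (∃ lf ∈ C.leaves, matchesB (lf.n.m.core.base.recs.map VarRec.cap) ks = true ∧ lf.LitsHold D) ∨
  (∃ F ∈ C.fams, F.B = C.B ∧ SuppIn D F.supp ∧ Present D F.sd0 F.τ)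

theorem coverTO_sound (C : CertO) (D : Design) (ks : List ℕ) (hks : ∀ k ∈ ks, k < 5) :
    ∀ (fuel : ℕ) (t : CTreeO) (asg : List (Option ℕ)) (p : OPath),
      coverTO C t fuel asg p = true →
      (asg.length = ks.length ∧ ∀ j m : ℕ, asg[j]? = some (some m) → ks[j]? = some m) → p.Holds D → LeafOrEFAO C D ks := by
  have hleaf : ∀ (fuel i : ℕ) (asg : List (Option ℕ)) (p : OPath), coverTO C (.leaf i) fuel asg p = true →
      (asg.length = ks.length ∧ ∀ j m : ℕ, asg[j]? = some (some m) → ks[j]? = some m) → p.Holds D → LeafOrEFAO C D ks := by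
    intro fuel i asg p h hag hp
    rcases hi : C.leaves[i]? with _ | lf
    · simp [coverTO, hi] at h
    · simp only [coverTO, hi] at h
      obtain ⟨hcaps, hlits⟩ := leafFitsO_sound h D hp
      subst hcaps
      exact Or.inl ⟨lf, List.mem_of_getElem? hi, matchesB_of_agrees hag, hlits⟩
  have hefa : ∀ (fuel j : ℕ) (asg : List (Option ℕ)) (p : OPath), coverTO C (.efa j) fuel asg p = true → p.Holds D → LeafOrEFAO C D ks := by
    intro fuel j asg p h hp
    rcases hj : C.fams[j]? with _ | F
    · simp [coverTO, hj] at h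
    · simp only [coverTO, hj] at h
      exact Or.inr ⟨F, List.mem_of_getElem? hj, efaFits_sound h D hp.1⟩
  intro fuel
  induction fuel with
  | zero =>
      intro t asg p h hag hp
      cases t with
      | leaf i => exact hleaf 0 i asg p h hag hp
      | efa j => exact hefa 0 j asg p h hp
      | node q kids => simp [coverTO] at h
      | disj sd τ A B => simp [coverTO] at h
      | kdisj sd τ ℓ A B => simp [coverTO] at h
      | mdisj sd τ k A B => simp [coverTO] at h
      | sdisj S A B => simp [coverTO] at h
      | obdisj sd o A B => simp [coverTO] at h
  | succ n ih =>
      intro t asg p h hag hp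
      cases t with
      | leaf i => exact hleaf (n + 1) i asg p h hag hp
      | efa j => exact hefa (n + 1) j asg p h hp
      | node q kids =>
          simp only [coverTO, Bool.and_eq_true, decide_eq_true_eq, List.all_eq_true] at h
          obtain ⟨⟨hq, hlen5⟩, hall⟩ := h
          have hqk : q < ks.length := by rw [← hag.1]; exact hq
          obtain ⟨k, hk⟩ : ∃ k, ks[q]? = some k := ⟨ks[q], List.getElem?_eq_getElem hqk⟩
          have hk5 : k < 5 := hks k (List.mem_of_getElem? hk)
          have hs := hall k (List.mem_range.mpr hk5)
          obtain ⟨s, hsk⟩ : ∃ s, kids[k]? = some s := ⟨kids[k]'(by omega), List.getElem?_eq_getElem (by omega)⟩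
          simp only [hsk] at hs
          exact ih s (setAt asg q k) p hs (agrees_setAt hag hk) hp
      | disj sd τ A B =>
          simp only [coverTO, Bool.and_eq_true] at h
          obtain ⟨hA, hB⟩ := h
          obtain ⟨⟨⟨⟨hb, hpr, hkb, hkp⟩, hle, hge⟩, hpo, hpn⟩, hqo, hqb⟩ := hp
          rcases Classical.em (Present D sd τ) with hyes | hno
          · refine ih B asg _ hB hag ⟨⟨⟨⟨hb, fun b hbm => ?_, hkb, hkp⟩, hle, hge⟩, hpo, hpn⟩, hqo, hqb⟩
            rcases List.mem_cons.mp hbm with rfl | hbm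
            · exact hyes
            · exact hpr b hbm
          · refine ih A asg _ hA hag ⟨⟨⟨⟨fun b hbm => ?_, hpr, hkb, hkp⟩, hle, hge⟩, hpo, hpn⟩, hqo, hqb⟩
            rcases List.mem_cons.mp hbm with rfl | hbm
            · exact banned_of_not_present hno
            · exact hb b hbm
      | kdisj sd τ ℓ A B =>
          simp only [coverTO, Bool.and_eq_true] at h
          obtain ⟨hA, hB⟩ := h
          obtain ⟨⟨⟨⟨hb, hpr, hkb, hkp⟩, hle, hge⟩, hpo, hpn⟩, hqo, hqb⟩ := hp
          rcases Classical.em (KPresent D sd τ ℓ) with hyes | hno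
          · refine ih B asg _ hB hag ⟨⟨⟨⟨hb, hpr, hkb, fun b hbm => ?_⟩, hle, hge⟩, hpo, hpn⟩, hqo, hqb⟩
            rcases List.mem_cons.mp hbm with rfl | hbm
            · exact hyes
            · exact hkp b hbm
          · refine ih A asg _ hA hag ⟨⟨⟨⟨hb, hpr, fun b hbm => ?_, hkp⟩, hle, hge⟩, hpo, hpn⟩, hqo, hqb⟩
            rcases List.mem_cons.mp hbm with rfl | hbm
            · exact kbanned_of_not_kpresent hno
            · exact hkb b hbm
      | mdisj sd τ k A B =>
          simp only [coverTO, Bool.and_eq_true] at h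
          obtain ⟨hA, hB⟩ := h
          obtain ⟨⟨⟨hK, hle, hge⟩, hpo, hpn⟩, hqo, hqb⟩ := hp
          rcases Classical.em (MassLE D sd τ k) with hyes | hno
          · refine ih A asg _ hA hag ⟨⟨⟨hK, fun b hbm => ?_, hge⟩, hpo, hpn⟩, hqo, hqb⟩
            rcases List.mem_cons.mp hbm with rfl | hbm
            · exact hyes
            · exact hle b hbm
          · refine ih B asg _ hB hag ⟨⟨⟨hK, hle, fun b hbm => ?_⟩, hpo, hpn⟩, hqo, hqb⟩
            rcases List.mem_cons.mp hbm with rfl | hbm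
            · exact massGE_of_not_massLE hno
            · exact hge b hbm
      | sdisj S A B =>
          simp only [coverTO, Bool.and_eq_true] at h
          obtain ⟨hA, hB⟩ := h
          obtain ⟨⟨hpM, hpo, hpn⟩, hqo, hqb⟩ := hp
          rcases Classical.em (SuppIn D S) with hyes | hno
          · refine ih A asg _ hA hag ⟨⟨hpM, fun S' hS' => ?_, hpn⟩, hqo, hqb⟩
            rcases List.mem_cons.mp hS' with rfl | hS'
            · exact hyes
            · exact hpo S' hS'
          · refine ih B asg _ hB hag ⟨⟨hpM, hpo, fun S' hS' => ?_⟩, hqo, hqb⟩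
            rcases List.mem_cons.mp hS' with rfl | hS'
            · exact outsideS_of_not_suppIn hno
            · exact hpn S' hS'
      | obdisj sd o A B =>
          simp only [coverTO, Bool.and_eq_true] at h
          obtain ⟨hA, hB⟩ := h
          obtain ⟨hpN, hqo, hqb⟩ := hp
          rcases Classical.em (OPresent D sd o) with hyes | hno
          · refine ih B asg _ hB hag ⟨hpN, fun q hq => ?_, hqb⟩
            rcases List.mem_cons.mp hq with rfl | hq
            · exact hyes
            · exact hqo q hq
          · refine ih A asg _ hA hag ⟨hpN, hqo, fun b hb => ?_⟩
            rcases List.mem_cons.mp hb with rfl | hb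
            · exact hno
            · exact hqb b hb

theorem rootCoverTO_sound (C : CertO) (D : Design) (t : CTreeO) (fuel : ℕ) (ks : List ℕ) (h : rootCoverTO C t fuel = true)
    (hlen : ks.length = C.vars.length) (hks : ∀ k ∈ ks, k < 5) (hk0 : ks.getD 0 0 ≠ 0) : LeafOrEFAO C D ks := by
  have hag0 : ((List.replicate C.vars.length (none : Option ℕ)).length = ks.length ∧ ∀ j m : ℕ,
      (List.replicate C.vars.length (none : Option ℕ))[j]? = some (some m) → ks[j]? = some m) := by
    exact ⟨by simp [hlen], fun _ _ h => absurd (List.eq_of_mem_replicate (List.mem_of_getElem? h)) (by simp)⟩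
  have hp0 := OPath.nil_holds D
  cases t with
  | leaf i =>
      simp only [rootCoverTO] at h
      exact coverTO_sound C D ks hks _ _ _ _ h hag0 hp0
  | efa j =>
      simp only [rootCoverTO] at h
      exact coverTO_sound C D ks hks _ _ _ _ h hag0 hp0
  | disj sd τ A B =>
      simp only [rootCoverTO] at h
      exact coverTO_sound C D ks hks _ _ _ _ h hag0 hp0
  | kdisj sd τ ℓ A B =>
      simp only [rootCoverTO] at h
      exact coverTO_sound C D ks hks _ _ _ _ h hag0 hp0
  | mdisj sd τ k A B =>
      simp only [rootCoverTO] at h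
      exact coverTO_sound C D ks hks _ _ _ _ h hag0 hp0
  | sdisj S A B =>
      simp only [rootCoverTO] at h
      exact coverTO_sound C D ks hks _ _ _ _ h hag0 hp0
  | obdisj sd o A B =>
      simp only [rootCoverTO] at h
      exact coverTO_sound C D ks hks _ _ _ _ h hag0 hp0
  | node q kids =>
      cases q with
      | succ q =>
          simp only [rootCoverTO] at h
          exact coverTO_sound C D ks hks _ _ _ _ h hag0 hp0
      | zero =>
          simp only [rootCoverTO, Bool.and_eq_true, decide_eq_true_eq, List.all_eq_true, Bool.or_eq_true] at h
          obtain ⟨⟨hn, hlen5⟩, hall⟩ := h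
          cases ks with
          | nil => simp at hlen; omega
          | cons a tl =>
              simp only [List.getD_cons_zero] at hk0
              have hk5 : a < 5 := hks a (by simp)
              have hs := hall a (List.mem_range.mpr hk5)
              rcases hs with hbad | hs
              · exact absurd hbad hk0
              obtain ⟨s, hsk⟩ : ∃ s, kids[a]? = some s := ⟨kids[a]'(by omega), List.getElem?_eq_getElem (by omega)⟩
              simp only [hsk] at hs
              exact coverTO_sound C D (a :: tl) hks _ _ _ _ hs (agrees_setAt hag0 (k := a) (q := 0) rfl) hp0

/-! ## §37 (Δ6b) The end-to-end theorems («v1 + L1.5 + ℤ + S + O») and the chunked replay interface -/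

theorem region_coverTO (C : CertO) (t : CTreeO) (fuel : ℕ) (hv : validTO C t fuel = true) (D : Design) (hA : D.OnAlphabet C.h) (h4 : D.A4)
    (c : Cell) (hc : c ∈ D.suppN ++ D.suppP) (f : Fin 4) (hfloor : (c f).a = 0) :
    (∃ lf ∈ C.leaves, InRegion C.vars lf.n.m.core.base D ∧
      (∀ sd : Side, ∀ c' ∈ suppSide D sd, admType C.h (allBounds C.vars lf.n.m.core.base) sd (typeOf c') = true) ∧ lf.LitsHold D) ∨
    (∃ F ∈ C.fams, F.B = C.B ∧ SuppIn D F.supp ∧ Present D F.sd0 F.τ) := by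
  have hv' := hv
  unfold validTO at hv'
  simp only [Bool.and_eq_true, decide_eq_true_eq] at hv'
  obtain ⟨⟨⟨hv0, hleaves⟩, _hfams⟩, hroot⟩ := hv'
  have hS1 := static_adm C.h D hA h4
  have hcP : c ∈ D.suppP := by
    rcases List.mem_append.mp hc with hcN | hcP
    · exfalso
      obtain ⟨x, hx, hlive⟩ := h4.2 c hcN
      have hlt := (hlive f).1
      have hx0 := (hA x (List.mem_append.mpr (Or.inr hx)) f).2
      omega
    · exact hcP
  have hks5 : ∀ k ∈ C.vars.map (kOf D), k < 5 := fun k hk => by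
    obtain ⟨v, _, rfl⟩ := List.mem_map.mp hk
    exact Nat.lt_succ_of_le (kOf_le_four D v)
  have hk0 : (C.vars.map (kOf D)).getD 0 0 ≠ 0 := by
    cases hvars : C.vars with
    | nil => rw [hvars] at hv0; simp at hv0
    | cons v0 rest =>
      rw [hvars] at hv0
      simp only [List.getElem?_cons_zero, Option.some.injEq] at hv0
      subst hv0
      simp only [List.map_cons, List.getD_cons_zero]
      have hcnt : 0 < (floorStat C.h).count (typeOf c) := by
        unfold Stat.count
        refine List.length_pos_of_mem (List.mem_filter.mpr ⟨List.mem_finRange f, ?_⟩)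
        refine List.elem_eq_true_of_mem (List.mem_filter.mpr ⟨by rw [admP0T_eq]; exact hS1.1 c hcP f, ?_⟩)
        simp [Shape.isFloor, shapeOf, typeOf, hfloor]
      have hle : (floorStat C.h).count (typeOf c) ≤ kOf D ⟨Side.P, floorStat C.h⟩ :=
        (isMax_kOf D ⟨Side.P, floorStat C.h⟩).1 c hcP
      omega
  rcases rootCoverTO_sound C D t fuel (C.vars.map (kOf D)) hroot (by simp) hks5 hk0 with ⟨lf, hlf, hmatch, hlits⟩ | hF
  · have hreg : InRegion C.vars lf.n.m.core.base D := inRegion_of_matchesB C.vars lf.n.m.core.base D hmatch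
    have hchk : checkLeafO C lf = true := List.all_eq_true.mp hleaves lf hlf
    exact Or.inl ⟨lf, hlf, hreg, adm_of_region C.toN.toM.toB lf.n.m.core.base (hder_of_checkLeafO hchk) D hA h4 hreg, hlits⟩
  · exact Or.inr hF

/-- **SOUNDNESS (ordered tree): `validTO C t fuel ⇒ FloorFree h B rmin`** (`leafO_sound` ∕ `efaFam_sound`) -/
theorem floorFree_of_validTO (C : CertO) (t : CTreeO) (fuel : ℕ) (hv : validTO C t fuel = true) : FloorFreeH C.h C.B C.rmin := by
  intro D hA h1 h4 _hμ hB hr c hc f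
  by_contra hle
  have ha0 := (hA c hc f).2
  have hfloor : (c f).a = 0 := by omega
  have hlf2 : C.leaves.all (fun lf => checkLeafO C lf) = true ∧ C.fams.all validEFAFam = true := by
    have hv' := hv
    unfold validTO at hv'
    simp only [Bool.and_eq_true] at hv'
    exact ⟨hv'.1.1.2, hv'.1.2⟩
  have hsides : D.suppN ≠ [] ∧ D.suppP ≠ [] := by
    rcases List.mem_append.mp hc with hcN | hcP
    · obtain ⟨x, hx, _⟩ := h4.2 c hcN
      exact ⟨List.ne_nil_of_mem hcN, List.ne_nil_of_mem hx⟩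
    · obtain ⟨y, hy, _⟩ := h4.1 c hcP
      exact ⟨List.ne_nil_of_mem hy, List.ne_nil_of_mem hcP⟩
  rcases region_coverTO C t fuel hv D hA h4 c hc f hfloor with ⟨lf, hlf, hreg, hadm, hlits⟩ | ⟨F, hF, hFB, hS, hpres⟩
  · have hchk : checkLeafO C lf = true := List.all_eq_true.mp hlf2.1 lf hlf
    exact leafO_sound C lf hchk D h1 h4 hB hr hsides.1 hsides.2 hreg hadm hlits
      (fun e _ k _ _ he => parity_even C.toN.toM.toB lf.n.m.core.base e.1 k e.2.par he D h1 hadm)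
  · have hval : validEFAFam F = true := List.all_eq_true.mp hlf2.2 F hF
    exact efaFam_sound F hval D h1 (by rw [hFB]; exact hB) hS hpres

/-- **PER-REGION SOUNDNESS** (one cap region — NOT `FloorFree`) -/
theorem regionEmpty_of_validRO (C : CertO) (t : CTreeO) (fuel : ℕ) (caps : List (Option ℕ)) (hv : validRO C t fuel caps = true)
    (D : Design) (hA : D.OnAlphabet C.h) (h1 : D.A1) (h4 : D.A4) (hB : D.copies ≤ C.B) (hr : C.rmin ≤ D.rank) (hN : D.suppN ≠ [])
    (hcaps : InCaps C.vars caps D) : False := by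
  have hv' := hv
  unfold validRO at hv'
  simp only [Bool.and_eq_true, decide_eq_true_eq] at hv'
  obtain ⟨⟨⟨hlen, hleaves⟩, hfams⟩, hcov⟩ := hv'
  have hP : D.suppP ≠ [] := by
    obtain ⟨y, hy⟩ := List.exists_mem_of_ne_nil _ hN
    obtain ⟨x, hx, _⟩ := h4.2 y hy
    exact List.ne_nil_of_mem hx
  have hks5 : ∀ k ∈ C.vars.map (kOf D), k < 5 := fun k hk => by
    obtain ⟨v, _, rfl⟩ := List.mem_map.mp hk
    exact Nat.lt_succ_of_le (kOf_le_four D v)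
  have hag : caps.length = (C.vars.map (kOf D)).length ∧
      ∀ j m : ℕ, caps[j]? = some (some m) → (C.vars.map (kOf D))[j]? = some m := by
    refine ⟨by simp [hlen], fun j m hj => ?_⟩
    obtain ⟨hjl, _⟩ := List.getElem?_eq_some_iff.mp hj
    obtain ⟨v, hvj⟩ : ∃ v, C.vars[j]? = some v := ⟨C.vars[j]'(by omega), List.getElem?_eq_getElem (by omega)⟩
    have hz : (List.zip C.vars caps)[j]? = some (v, some m) := List.getElem?_zip_eq_some.mpr ⟨hvj, hj⟩
    have hmax := hcaps _ (List.mem_of_getElem? hz) m rfl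
    rw [List.getElem?_map, hvj]
    exact congrArg some (isMax_unique (isMax_kOf D v) hmax)
  rcases coverTO_sound C D (C.vars.map (kOf D)) hks5 fuel t caps OPath.nil hcov hag (OPath.nil_holds D) with ⟨lf, hlf, hmatch, hlits⟩ | ⟨F, hF, hFB, hS, hpres⟩
  · have hreg : InRegion C.vars lf.n.m.core.base D := inRegion_of_matchesB C.vars lf.n.m.core.base D hmatch
    have hchk : checkLeafO C lf = true := List.all_eq_true.mp hleaves lf hlf
    have hadm := adm_of_region C.toN.toM.toB lf.n.m.core.base (hder_of_checkLeafO hchk) D hA h4 hreg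
    exact leafO_sound C lf hchk D h1 h4 hB hr hN hP hreg hadm hlits
      (fun e _ k _ _ he => parity_even C.toN.toM.toB lf.n.m.core.base e.1 k e.2.par he D h1 hadm)
  · have hval : validEFAFam F = true := List.all_eq_true.mp hfams F hF
    exact efaFam_sound F hval D h1 (by rw [hFB]; exact hB) hS hpres

theorem regionEmpty_of_validRO' (C : CertO) (t : CTreeO) (fuel : ℕ) (caps : List (Option ℕ)) (hv : validRO C t fuel caps = true)
    (hpos : 0 < C.rmin) (D : Design) (hA : D.OnAlphabet C.h) (h1 : D.A1) (h4 : D.A4) (hB : D.copies ≤ C.B) (hr : C.rmin ≤ D.rank)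
    (hcaps : InCaps C.vars caps D) : False :=
  regionEmpty_of_validRO C t fuel caps hv D hA h1 h4 hB hr (suppN_ne_nil_of_rank D C.rmin hr hpos) hcaps

theorem validTO_intro (C : CertO) (t : CTreeO) (fuel : ℕ) (h0 : C.vars[0]? = some ⟨Side.P, floorStat C.h⟩)
    (hl : ∀ lf ∈ C.leaves, checkLeafO C lf = true) (hf : ∀ F ∈ C.fams, validEFAFam F = true) (hc : rootCoverTO C t fuel = true) :
    validTO C t fuel = true := by
  unfold validTO
  simp only [Bool.and_eq_true, decide_eq_true_eq, List.all_eq_true]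
  exact ⟨⟨⟨h0, hl⟩, hf⟩, hc⟩

theorem validRO_intro (C : CertO) (t : CTreeO) (fuel : ℕ) (caps : List (Option ℕ)) (h0 : caps.length = C.vars.length)
    (hl : ∀ lf ∈ C.leaves, checkLeafO C lf = true) (hf : ∀ F ∈ C.fams, validEFAFam F = true) (hc : coverTO C t fuel caps OPath.nil = true) :
    validRO C t fuel caps = true := by
  unfold validRO
  simp only [Bool.and_eq_true, decide_eq_true_eq, List.all_eq_true]
  exact ⟨⟨⟨h0, hl⟩, hf⟩, hc⟩

/-- **end theorem from chunks** (ordered): leaf lemmas + EFA-family lemmas + structural cover ⇒ `FloorFreeH` -/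
theorem floorFree_of_chunksO (C : CertO) (t : CTreeO) (fuel : ℕ) (h0 : C.vars[0]? = some ⟨Side.P, floorStat C.h⟩)
    (hl : ∀ lf ∈ C.leaves, checkLeafO C lf = true) (hf : ∀ F ∈ C.fams, validEFAFam F = true) (hc : rootCoverTO C t fuel = true) :
    FloorFreeH C.h C.B C.rmin :=
  floorFree_of_validTO C t fuel (validTO_intro C t fuel h0 hl hf hc)

/-- **region-level end theorem from chunks** («v1 + L1.5 + ℤ + S + O») -/
theorem regionEmpty_of_chunksO (C : CertO) (t : CTreeO) (fuel : ℕ) (caps : List (Option ℕ)) (h0 : caps.length = C.vars.length)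
    (hl : ∀ lf ∈ C.leaves, checkLeafO C lf = true) (hf : ∀ F ∈ C.fams, validEFAFam F = true) (hc : coverTO C t fuel caps OPath.nil = true)
    (D : Design) (hA : D.OnAlphabet C.h) (h1 : D.A1) (h4 : D.A4) (hB : D.copies ≤ C.B) (hr : C.rmin ≤ D.rank) (hN : D.suppN ≠ [])
    (hcaps : InCaps C.vars caps D) : False :=
  regionEmpty_of_validRO C t fuel caps (validRO_intro C t fuel caps h0 hl hf hc) D hA h1 h4 hB hr hN hcaps

/-- a root path carrying ONE class-presence literal (the root split of a half-region certificate, e.g. «m³b present on P») -/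
def OPath.ofPres (sd : Side) (τ : STuple) : OPath := ⟨⟨⟨[], [(sd, τ)], [], [], [], []⟩, [], []⟩, [], []⟩

theorem OPath.ofPres_holds (D : Design) (sd : Side) (τ : STuple) (h : Present D sd τ) : (OPath.ofPres sd τ).Holds D := by
  refine ⟨⟨⟨⟨by simp [OPath.ofPres, MPath.toK], ?_, by simp [OPath.ofPres, MPath.toK], by simp [OPath.ofPres, MPath.toK]⟩,
    by simp [OPath.ofPres], by simp [OPath.ofPres]⟩, by simp [OPath.ofPres], by simp [OPath.ofPres]⟩,
    by simp [OPath.ofPres], by simp [OPath.ofPres]⟩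
  intro q hq
  simp only [OPath.ofPres, MPath.toK, List.mem_singleton] at hq
  subst hq
  exact h

/-- **HALF-REGION end theorem from chunks** (ordered): as `regionEmpty_of_chunksO` but the structural cover starts from a root PATH `p` whose
literals hold in `D` (e.g. `OPath.ofPres Side.P τ` with `Present D Side.P τ`) — closes `InCaps ∧ p.Holds`, i.e. ONE HALF of a cap region. -/
theorem regionPathEmpty_of_chunksO (C : CertO) (t : CTreeO) (fuel : ℕ) (caps : List (Option ℕ)) (p : OPath) (h0 : caps.length = C.vars.length)
    (hl : ∀ lf ∈ C.leaves, checkLeafO C lf = true) (hf : ∀ F ∈ C.fams, validEFAFam F = true) (hc : coverTO C t fuel caps p = true)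
    (D : Design) (hA : D.OnAlphabet C.h) (h1 : D.A1) (h4 : D.A4) (hB : D.copies ≤ C.B) (hr : C.rmin ≤ D.rank) (hN : D.suppN ≠ [])
    (hcaps : InCaps C.vars caps D) (hp : p.Holds D) : False := by
  have hP : D.suppP ≠ [] := by
    obtain ⟨y, hy⟩ := List.exists_mem_of_ne_nil _ hN
    obtain ⟨x, hx, _⟩ := h4.2 y hy
    exact List.ne_nil_of_mem hx
  have hks5 : ∀ k ∈ C.vars.map (kOf D), k < 5 := fun k hk => by
    obtain ⟨v, _, rfl⟩ := List.mem_map.mp hk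
    exact Nat.lt_succ_of_le (kOf_le_four D v)
  have hag : caps.length = (C.vars.map (kOf D)).length ∧
      ∀ j m : ℕ, caps[j]? = some (some m) → (C.vars.map (kOf D))[j]? = some m := by
    refine ⟨by simp [h0], fun j m hj => ?_⟩
    obtain ⟨hjl, _⟩ := List.getElem?_eq_some_iff.mp hj
    obtain ⟨v, hvj⟩ : ∃ v, C.vars[j]? = some v := ⟨C.vars[j]'(by omega), List.getElem?_eq_getElem (by omega)⟩
    have hz : (List.zip C.vars caps)[j]? = some (v, some m) := List.getElem?_zip_eq_some.mpr ⟨hvj, hj⟩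
    have hmax := hcaps _ (List.mem_of_getElem? hz) m rfl
    rw [List.getElem?_map, hvj]
    exact congrArg some (isMax_unique (isMax_kOf D v) hmax)
  rcases coverTO_sound C D (C.vars.map (kOf D)) hks5 fuel t caps p hc hag hp with ⟨lf, hlf, hmatch, hlits⟩ | ⟨F, hF, hFB, hS, hpres⟩
  · have hreg : InRegion C.vars lf.n.m.core.base D := inRegion_of_matchesB C.vars lf.n.m.core.base D hmatch
    have hchk : checkLeafO C lf = true := hl lf hlf
    have hadm := adm_of_region C.toN.toM.toB lf.n.m.core.base (hder_of_checkLeafO hchk) D hA h4 hreg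
    exact leafO_sound C lf hchk D h1 h4 hB hr hN hP hreg hadm hlits
      (fun e _ k _ _ he => parity_even C.toN.toM.toB lf.n.m.core.base e.1 k e.2.par he D h1 hadm)
  · exact efaFam_sound F (hf F hF) D h1 (by rw [hFB]; exact hB) hS hpres

/-- positive-`rmin` form of the half-region end theorem -/
theorem regionPathEmpty_of_chunksO' (C : CertO) (t : CTreeO) (fuel : ℕ) (caps : List (Option ℕ)) (p : OPath) (h0 : caps.length = C.vars.length)
    (hl : ∀ lf ∈ C.leaves, checkLeafO C lf = true) (hf : ∀ F ∈ C.fams, validEFAFam F = true) (hc : coverTO C t fuel caps p = true)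
    (hpos : 0 < C.rmin) (D : Design) (hA : D.OnAlphabet C.h) (h1 : D.A1) (h4 : D.A4) (hB : D.copies ≤ C.B) (hr : C.rmin ≤ D.rank)
    (hcaps : InCaps C.vars caps D) (hp : p.Holds D) : False :=
  regionPathEmpty_of_chunksO C t fuel caps p h0 hl hf hc D hA h1 h4 hB hr (suppN_ne_nil_of_rank D C.rmin hr hpos) hcaps hp


/-! ## §38 (Δ6b) Smoke tests (FAKE data): path discipline of `obdisj` ∕ ordered literals, exactness of the ordered pay, orderings of a class -/
section SmokeO

/-- the m³b orderings: `ordsOf` lists 24 with repetitions; exactly the 4 positions of the `(2;2,2)` slot are distinct -/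
example : (ordsOf ![⟨0, 3, 3⟩, ⟨0, 3, 3⟩, ⟨0, 3, 3⟩, ⟨2, 2, 2⟩]).length = 24 := by decide
example : ((ordsOf ![⟨0, 3, 3⟩, ⟨0, 3, 3⟩, ⟨0, 3, 3⟩, ⟨2, 2, 2⟩]).map fun t => (t 0).a + 2 * (t 1).a + 3 * (t 2).a + 4 * (t 3).a).eraseDups.length = 4 := by
  decide
/-- the ordered pay is EXACT: a slot permutation of `o` is not hit, the other side is not hit -/
example : oPay [⟨Side.P, ![⟨2, 2, 2⟩, ⟨0, 3, 3⟩, ⟨0, 3, 3⟩, ⟨0, 3, 3⟩], 5⟩] Side.P ![⟨2, 2, 2⟩, ⟨0, 3, 3⟩, ⟨0, 3, 3⟩, ⟨0, 3, 3⟩] = 5 := by decide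
example : oPay [⟨Side.P, ![⟨2, 2, 2⟩, ⟨0, 3, 3⟩, ⟨0, 3, 3⟩, ⟨0, 3, 3⟩], 5⟩] Side.P ![⟨0, 3, 3⟩, ⟨2, 2, 2⟩, ⟨0, 3, 3⟩, ⟨0, 3, 3⟩] = 0 := by decide
example : oPay [⟨Side.P, ![⟨2, 2, 2⟩, ⟨0, 3, 3⟩, ⟨0, 3, 3⟩, ⟨0, 3, 3⟩], 5⟩] Side.N ![⟨2, 2, 2⟩, ⟨0, 3, 3⟩, ⟨0, 3, 3⟩, ⟨0, 3, 3⟩] = 0 := by decide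
example : obanHit [(Side.N, τ0)] Side.N τ0 = true := by decide
example : obanHit [(Side.N, τ0)] Side.N ![⟨2, 2, 2⟩, ⟨0, 3, 3⟩, ⟨0, 3, 3⟩, ⟨0, 3, 3⟩] = false := by decide
/-- the ordered aggregated cover pay (SAME-SLOT cover, no permutation): `−V` on the row's own ordered P-column `o = (b; m, m, m)`; `+V·B` on the
N-column `t = (⟨6,0,0⟩; ⟨4,2,0⟩, ⟨4,2,0⟩, ⟨4,2,0⟩)` (slot 0 amply above `b`, slots 1–3 amply above `m` but NOT above `b`); `0` on the same N-column
for the PERMUTED P-column `(m; b, m, m)` (slot 1: `⟨4,2,0⟩` is not above `b`) — the multiset cover row of Δ4 would pay on both -/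
example : oaggPay 199 [⟨Side.P, ![⟨2, 2, 2⟩, ⟨0, 3, 3⟩, ⟨0, 3, 3⟩, ⟨0, 3, 3⟩], 2⟩] Side.P ![⟨2, 2, 2⟩, ⟨0, 3, 3⟩, ⟨0, 3, 3⟩, ⟨0, 3, 3⟩] = -2 := by decide
example : oaggPay 199 [⟨Side.P, ![⟨2, 2, 2⟩, ⟨0, 3, 3⟩, ⟨0, 3, 3⟩, ⟨0, 3, 3⟩], 2⟩] Side.N ![⟨6, 0, 0⟩, ⟨4, 2, 0⟩, ⟨4, 2, 0⟩, ⟨4, 2, 0⟩] = 398 := by decide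
example : oaggPay 199 [⟨Side.P, ![⟨0, 3, 3⟩, ⟨2, 2, 2⟩, ⟨0, 3, 3⟩, ⟨0, 3, 3⟩], 2⟩] Side.N ![⟨6, 0, 0⟩, ⟨4, 2, 0⟩, ⟨4, 2, 0⟩, ⟨4, 2, 0⟩] = 0 := by decide
example : covUp ![⟨0, 3, 3⟩, ⟨2, 2, 2⟩, ⟨0, 3, 3⟩, ⟨0, 3, 3⟩] ![⟨6, 0, 0⟩, ⟨4, 2, 0⟩, ⟨4, 2, 0⟩, ⟨4, 2, 0⟩] = true := by decide

def fakeLeafO (caps : List (Option ℕ)) (pres : List Pres) (ngs : List NoGood) (ops : List OPres) (obans : List (Side × STuple)) : LeafO :=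
  ⟨fakeLeafN caps pres ngs, [], ops, obans, []⟩

/-- FLOOR = 2: class branch on m³b; present side: ordered branch on the ordering `o = (2;2,2)(0;3,3)³`: absent ⇒ a leaf carrying that ordered ban,
present ⇒ `sdisj` (inside: the EFA family leaf; outside: a leaf carrying the ordered presence literal `(P, o, Z = 5)` and the no-good) -/
def fakeCO : CertO :=
  {h := 6, B := 199, rmin := 8, vars := [⟨Side.P, floorStat 6⟩],
   leaves := [fakeLeafO [some 1] [] [] [] [], fakeLeafO [some 2] [] [] [] [],
              fakeLeafO [some 2] [] [] [] [(Side.P, ![⟨2, 2, 2⟩, ⟨0, 3, 3⟩, ⟨0, 3, 3⟩, ⟨0, 3, 3⟩])],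
              fakeLeafO [some 2] [] [⟨efa4273a5S, 3⟩] [⟨Side.P, ![⟨2, 2, 2⟩, ⟨0, 3, 3⟩, ⟨0, 3, 3⟩, ⟨0, 3, 3⟩], 5⟩] [],
              fakeLeafO [some 3] [] [] [] [], fakeLeafO [some 4] [] [] [] []],
   fams := [fakeFam]}

def fakeTO : CTreeO :=
  .node 0 [.leaf 0, .leaf 0,
    .disj Side.P ![⟨0, 3, 3⟩, ⟨0, 3, 3⟩, ⟨0, 3, 3⟩, ⟨2, 2, 2⟩] (.leaf 1)
      (.obdisj Side.P ![⟨2, 2, 2⟩, ⟨0, 3, 3⟩, ⟨0, 3, 3⟩, ⟨0, 3, 3⟩] (.leaf 2) (.sdisj efa4273a5S (.efa 0) (.leaf 3))),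
    .leaf 4, .leaf 5]

example : rootCoverTO fakeCO fakeTO 4 = true := by decide
/-- the ordered-ban leaf on the PRESENT side and the ordered-presence leaf on the ABSENT side are rejected -/
example : rootCoverTO fakeCO (.node 0 [.leaf 0, .leaf 0,
    .disj Side.P ![⟨0, 3, 3⟩, ⟨0, 3, 3⟩, ⟨0, 3, 3⟩, ⟨2, 2, 2⟩] (.leaf 1)
      (.obdisj Side.P ![⟨2, 2, 2⟩, ⟨0, 3, 3⟩, ⟨0, 3, 3⟩, ⟨0, 3, 3⟩] (.sdisj efa4273a5S (.efa 0) (.leaf 3)) (.leaf 2)),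
    .leaf 4, .leaf 5]) 4 = false := by decide
/-- a leaf using an ordered presence literal with NO `obdisj` above it is rejected -/
example : rootCoverTO fakeCO (.node 0 [.leaf 0, .leaf 0,
    .disj Side.P ![⟨0, 3, 3⟩, ⟨0, 3, 3⟩, ⟨0, 3, 3⟩, ⟨2, 2, 2⟩] (.leaf 1) (.sdisj efa4273a5S (.efa 0) (.leaf 3)),
    .leaf 4, .leaf 5]) 4 = false := by decide
/-- the ordered literal is matched SYNTACTICALLY: branching on a slot permutation of `o` does not license the leaf that names `o` -/
example : rootCoverTO fakeCO (.node 0 [.leaf 0, .leaf 0,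
    .disj Side.P ![⟨0, 3, 3⟩, ⟨0, 3, 3⟩, ⟨0, 3, 3⟩, ⟨2, 2, 2⟩] (.leaf 1)
      (.obdisj Side.P ![⟨0, 3, 3⟩, ⟨2, 2, 2⟩, ⟨0, 3, 3⟩, ⟨0, 3, 3⟩] (.leaf 1) (.sdisj efa4273a5S (.efa 0) (.leaf 3))),
    .leaf 4, .leaf 5]) 4 = false := by decide

end SmokeO

end Summit.HodgeConjecture.HodgeConjecture.Cruxes.BlochSeedDiscOne.BnCCertCover
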